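import Literature.MathematicalPhysics.QuantumFieldTheory.Balaban1983to89.B9Eq3185
import Literature.MathematicalPhysics.QuantumFieldTheory.Balaban1983to89.B9Eq3184
import Literature.MathematicalPhysics.QuantumFieldTheory.Balaban1983to89.B9Thm312Positivity
import Literature.MathematicalPhysics.QuantumFieldTheory.Balaban1983to89.B9Thm37AllNorms

/-!
# `Balaban1983to89.B9Eq3186G2Perturbation` — T. Bałaban, *Propagators for lattice gauge theories in a background field*, Commun. Math. Phys.
**99** (1985) 389–434 [Balaban1985BackgroundPropagators], Sect. E p. 432, THE UNDISPLAYED SENTENCE AFTER (3.186): «The operator G₂ differs from G₁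
only by the small and regular operators connected with the second term in the exponential in (3.183), and with terms containing Dλ̃(A). Thus we
can investigate the operator G₂ perturbatively in the same way as the operator G₁ in (3.138). The analysis is even simpler because the new terms
are more regular, as it follows easily from (3.184).» — TYPED AND KERNEL-CHECKED at the matrix-letter level of this lineage's (3.183)/(3.184)/(3.185)
(`B9Eq3184`, `B9Eq3185`) and of r06's (3.130)/(3.138) programme (`B9Thm312Positivity`, `B9Eq3130Neumann`, `B9Eq3120StepDelta1Pi`, `B9Eq3130MatrixLetters`):
(i) THE ALGEBRA — `G₂⁻¹ = G₁♮⁻¹ + W_new` with `W_new = −2Pᵀ𝒥P + T̃ᵀ(W₀D)Λ̃ + Λ̃ᵀ(DᵀW₀)T̃ + Λ̃ᵀ(DᵀW₀)DΛ̃`, every summand carrying the `J`-form `𝒥` of the second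
term of the exponent or the (3.117)/(3.137) gauge-variation letters `(Δ + Δ⁽²⁾)D`, `Dᵀ(Δ + Δ⁽²⁾)`; (ii) THE ESTIMATE — the block majorant `c_W·Mα₀·e^{−ρd}`
of `W_new` from letters of printed shape; (iii) THE RESOLVENT STEP «in the same way as G₁ in (3.138)» — `G₂ = G₁♮(I + W_newG₁♮)⁻¹ = Σₙ G₁♮(−W_newG₁♮)ⁿ`,
positive, with a block majorant of the same exponential shape as `G₁♮`'s.  Cell pub-ymgap, seat dag-n06-b (N06 = [B9], -b FIRST-MISSING-ESTIMATE; GAPS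
G-B9-10 (a) «no estimate of the G₂ − G₁ terms of (3.183)–(3.184)», the OBJECTION recorded on the typed Theorem 3.15 `B9.Thm315Printed`/`B9.Thm315FullPrinted`).

statement-level bookkeeping of a by-reference sentence with citation tags; proofs where landed; nothing here is a claim about the Yang–Mills mass gap

CITATION HEADER (lean-in-tree rule).  B9 = [Balaban1985BackgroundPropagators] (held `paper:balaban1985-cmp99-background-propagators`, journal page =
PDF page + 388; text pages p0030–p0044 re-read by this seat 2026-08-26, renders `b2b-balaban-ref1/pages/1985-cmp99-background-propagators/…-p044-x2.png`
for p. 432).  WHAT IS PRINTED (verbatim):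
* p. 421 [PDF 33], (3.128): «by G₁ the operator defined by the quadratic form … = ⟨A − DG′RD\*A, Δ(A − DG′RD\*A)⟩ − 2⟨HC₁⁽²⁾(A − DG′RD\*A), J⟩
  + ‖RD\*A‖² + a‖QA‖². (3.128)»; p. 423 [PDF 35], (3.137)–(3.138): «|(Δ⁽²⁾A)(b)| ≦ O(1)Mα₀(Lʲη)⁻²|A|, b ∈ Δ(y), y ∈ Λ_j (3.137) and the supremum |A| is
  taken over several j-blocks surrounding Δ(y). This bound implies that the operators Δ⁽²⁾, Δ₁⁽²⁾ are small in a proper sense, if α₀ is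
  sufficiently small. Similarly as in (3.130) we get G₁ = G₀(I − (Δ′_π + Δ₁⁽²⁾)G₀)⁻¹ = Σ_{n=0}^∞ G₀((Δ′_π + Δ₁⁽²⁾)G₀)ⁿ. (3.138)»;
* p. 419 [PDF 31], (3.117): «⟨A − Dλ, Δ(A − Dλ)⟩ = ⟨A, ΔA⟩ − ⟨i[λ(b₋), A(b)] − i[A(b), R_bλ(b₊)] − i[λ(b₋), (Dλ)(b)], J⟩. (3.117) The last equality can
  be interpreted as almost invariance of the quadratic form, the error terms are small because the function J = D\*η⁻² Im ∂U is small, if U satisfies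
  the condition (3.36).»;
* p. 431 [PDF 43]: «Let us notice that by (3.163) we have ΔH′μ = G′Q′\*(Q′G′²Q′\*)⁻¹(μ − aQ′G′Q′\*μ), (3.177) hence ΔH′μ is a regular function, more
  exactly, DΔH′μ is bounded, and even Hölder norms are bounded.»;
* p. 432 [PDF 44]: «exp(½⟨g, C⁽ᵏ⁾(Λ)g⟩) = Z̃⁻¹∫dA δ(Q̃A) exp[−½‖R̃D\*A‖² + ⟨H₁D̃⁽²⁾(QA + D̄μ(QA)), J⟩ − ½⟨A − DG̃′R̃D\*A + Dλ̃(A), (Δ + Δ⁽²⁾)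
  (A − DG̃′R̃D\*A + Dλ̃(A))⟩ + ⟨QA + D̄μ(QA), g⟩], (3.183) where λ̃(A) = H′C′⁽ᵏ⁾(Λ)H′\*ΔP̃D\*A + H′μ(QA) + H′Q′G̃′R̃D\*A. (3.184) … The operator G̃₂ can be
  related in a simple way to the operator G₂ defined by the Gaussian integral (3.183), but with the δ-function δ(Q̃A) replaced by exp[−½⟨Q̃A, aQ̃A⟩].
  We have G̃₂ = G₂ − G₂Q̃\*(Q̃G₂Q̃\*)⁻¹Q̃G₂. (3.186)» followed by THE SENTENCE typed here (quoted in the title) and «This way we can express C⁽ᵏ⁾(Λ) in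
  terms of the operators of the type G′, (Q′G′²Q′\*)⁻¹, G, (QGQ\*)⁻¹. Expanding these into random walks we get a random walk expansion of C⁽ᵏ⁾(Λ).»
[4] = [Balaban1984PropagatorsII] (2.51)–(2.55) p. 232 («this property is preserved under the composition of operators possessing it … A summation
preserves it also»), Lemma 2.1 (2.61) p. 234.

THE READING (typing choices, recorded for the cell's DIVERGENCE register; a typing, not a claim about the print).
(a) `G₂⁻¹`.  By `B9Eq3185.genFun_3183`/`eq_3185_via_G2` the exponent of (3.183) is `−½⟨A, K₃₁₈₃A⟩` with `K₃₁₈₃ = (R̃D*)ᵀ(R̃D*) − 2Pᵀ𝒥P + Tᵀ(Δ + Δ⁽²⁾)T`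
    (`P = (1 + D̄μ)Q` the observation, `𝒥` the real matrix of the form `B ↦ ⟨H₁D̃⁽²⁾(B), J⟩`, `T` the configuration map), and `G₂ = (K₃₁₈₃ + aQ̃ᵀQ̃)⁻¹`.
    Here `T = T̃ + DΛ̃` with `T̃ = 1 − DG̃′R̃D*` and `Λ̃` the matrix of `λ̃` (§1 `config3183_eq_mulVec`, `lamT_eq_mulVec`: LITERALLY `B9Eq3184.aPrime` +
    `D·B9Eq3184.lamT` when `μ` is a matrix); `W₀` denotes the matrix of `(Δ + Δ⁽²⁾)`.
(b) «G₁».  The operator print compares with is the one OF THE TYPE (3.128) built from the SAME letters WITHOUT the two new terms: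
    `G₁♮⁻¹ := (R̃D*)ᵀ(R̃D*) + T̃ᵀW₀T̃ + aQ̃ᵀQ̃` («⟨A − DG′RD\*A, (…)(A − DG′RD\*A)⟩ + ‖RD\*A‖² + a‖QA‖²» of (3.128) at the wavy `G̃′, R̃, Q̃` and the
    form `Δ + Δ⁽²⁾` of (3.183)).  Whether `G₁♮` coincides with the wavy sequence's own `G̃₁` (wavy `Δ̃⁽²⁾`, `H̃`) is NOT asserted: what the perturbation
    step needs is that `G₁♮` is an operator to which Theorem 3.12 applies — its positivity (`hK₁`) and its block majorant (`hG₁`) are HYPOTHESES of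
    printed shape («Theorems 3.3, 3.10, 3.11 hold for the propagators G, G₁», Thm 3.12 p. 423; r06 FILE 83 `B9Eq3130MatrixLetters.thm312_posDef_G1_letters`
    is the kernel precedent deriving them from letters for p10's concrete shapes).
(c) «small».  The `J`-term carries the small factor `m = Mα₀` through the letter `𝒥` ((3.36) + (3.133): «|(H\*J)(b)| ≦ O(1)Mα₀(Lʲη)⁻³», p. 422, and
    D̃⁽²⁾ quadratic with bounded coefficients, p. 427 «properties similar to C⁽²⁾(A)»); the «terms containing Dλ̃(A)» carry it through the letters
    `(Δ + Δ⁽²⁾)D` and `Dᵀ(Δ + Δ⁽²⁾)` — the first-order gauge variation of the Hessian, small by (3.117)+(3.36) exactly as in r06 FILE 82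
    `B9Eq3120StepDelta1Pi` (letters `K·D`, `D*·K` of size `c_J·Mα₀`), plus (3.137) for `Δ⁽²⁾` (§5 `hasMaj_E_of_3117_3137`, `hasMaj_Et_of_3117_3137`).
(d) «regular, as it follows easily from (3.184)».  `Λ̃` is a sum of three words in regular letters — `H′`, `C′⁽ᵏ⁾(Λ)`, `H′*Δ` ((3.177): «ΔH′μ is a
    regular function»), `P̃D*` ((3.49)₃), `μ`, `Q`, `Q′`, `G̃′R̃D*` (Theorem 3.1 ∘ (3.49), r06 FILE 83 `hasMaj_GpRDt`) — hence has a block majorant of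
    printed exponential shape WITHOUT a small factor (§5 `hasMaj_lam_of_3184`); likewise `P = Q + D̄μQ` (§5 `hasMaj_P_of_letters`; `μ` local with the
    constants of `B9Eq3169Comb`/`B9Eq3187Op`).
(e) CURRENCY.  r16's block norms `B11SectG.BlockNorm`/`HasMaj` (§2, §5: ABSTRACT norms `bX` on fine-bond functions, `bN` on fine-site functions, `bB` on the
    observed-field functions, `bM` on the `μ`-sites; scale weights ride inside the norms as in r06 FILES 78–83), [4] (2.52)–(2.55) compositions at one
    row-sum rate `σ` each (`hasMaj_comp_exp`), letters at the rate `δ₁`, words at `ρ` with `ρ + σ ≦ δ₁`; §3–§4 on the sharp-block SUP sizes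
    `BlockNorm.ofBlocks` of real coordinates (κ = 1), where block majorants give row sums (`B9Thm312Positivity.rowSum_le_of_hasMaj_exp`) and hence the
    sup-operator-norm convergence of the Neumann series, as r06 reads «the series (3.138) is convergent».

WHAT IS PROVED (kernel; theorems only — 0 `def`, 0 named fact, 0 sorry; axioms standard).
* §1 ALGEBRA (any real matrices, any finite index types): `config_transpose_mul_expand`; **`K2_sub_K1`** — `(K₃₁₈₃(R̃D*, 𝒥, P, W₀, T̃ + DΛ̃) + aQ̃ᵀQ̃) −
  G₁♮⁻¹ = −2Pᵀ𝒥P + [T̃ᵀ(W₀D)Λ̃ + Λ̃ᵀ(DᵀW₀)T̃ + Λ̃ᵀ(DᵀW₀)(DΛ̃)]` (the sentence's «only by … the second term … and … terms containing Dλ̃(A)», EXACT);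
  `Wnew_transpose` (the new terms are symmetric for symmetric `𝒥`, `W₀`), `K1_transpose`; the edges to (3.183)/(3.184): `lamT_eq_mulVec` (`B9Eq3184.lamT`
  with a matrix `μ` IS `Λ̃·A`, `Λ̃ = H′C′H′ᵀΔ(1 − R̃)Dᵀ + H′μQ + H′Q′G̃′R̃Dᵀ`), `config3183_eq_mulVec` (`B9Eq3184.aPrime A + D·lamT A = (T̃ + DΛ̃)A`).
* §2 ESTIMATE (abstract block norms): `hasMaj_Jword` (`Pᵀ𝒥P`), `hasMaj_word2` (`T̃ᵀ(W₀D)Λ̃`), `hasMaj_word3` (`Λ̃ᵀ(DᵀW₀)T̃`), `hasMaj_word4`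
  (`Λ̃ᵀ(DᵀW₀)DΛ̃`), **`hasMaj_newTerms`** — from the letters `𝒥` (`c_J·m`), `P`, `Pᵀ`, `(W₀D)` (`c_E·m`), `(DᵀW₀)` (`c_E′·m`), `T̃`, `T̃ᵀ`, `Λ̃`, `Λ̃ᵀ`, `D`
  (each `C·e^{−δ₁d}`) the new terms have the majorant `c_W·m·e^{−ρd}`, `c_W = 2κ_B²C_P′c_JC_Pc² + κ_Xκ_NC_T′c_EC_Λc² + κ_Nκ_XC_Λ′c_E′C_Tc² +
  κ_N²κ_XC_Λ′c_E′C_DC_Λc³` — ONE factor `m = Mα₀` in every summand («small»), exponential shape («regular»).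
* §3 RESOLVENT («in the same way as the operator G₁ in (3.138)», sharp blocks, any symmetric `K₁ > 0` and symmetric `W`): `rowSums_mul_le` (block majorants
  ⟹ row sums of `|WG|` ≤ `B_G(c_Wm)c²`); **`g2_expansion`** — with `G₁♮ = K₁⁻¹` of majorant `B_Ge^{−δ₁d}`, `W` of majorant `c_Wme^{−δ₁d}`, `2σ ≦ δ₁` and the
  smallness `B_G·c_W·m·c² < 1` («Mα₀ sufficiently small»): `I + WG₁♮` is invertible, `G₂ := G₁♮(I + WG₁♮)⁻¹` is a two-sided inverse of `K₁ + W`, equals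
  `(K₁ + W)⁻¹`, is symmetric and POSITIVE DEFINITE, `K₁ + W` is positive definite, and `Σₙ G₁♮(−WG₁♮)ⁿ → G₂` in the sup operator norm
  (`B9Thm312Positivity.expansion_posDef` + `B9Eq3130Neumann.eq3130_hasSum` BY NAME — the SAME theorems that read (3.130)/(3.138)); **`g2_majorant`** — any
  `G₂` with `(K₁ + W)G₂ = I` has the block majorant `B_G(1 − B_Gc_Wmc²)⁻¹e^{−(δ₁−2σ)d}` (the fixed point `G₂ = G₁♮ − G₁♮WG₂`, r16 `B11SectG.neumann_majorant`,
  a-priori bound `B9Thm37AllNorms.exists_hasMaj_const_ofBlocks`).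
* §4 END TO END at the letters of (3.183): `mulVecLin_newTerms` (the new terms ARE §2's word in the matrix letters) and **`g2_of_letters`** — for
  `K₂ := K₃₁₈₃(R̃D*, 𝒥, P, W₀, T̃ + DΛ̃) + aQ̃ᵀQ̃` (`𝒥`, `W₀` symmetric): (i) `K₂ = G₁♮⁻¹ + W_new`; given Theorem 3.12 for `G₁♮` (`hK₁`, `hG₁`), the ten
  letters on sharp blocks of three carriers (fine bonds, fine sites, observed-field bonds), `3σ ≦ δ₁` and `B_G·c_W·m·c² < 1`: (ii) `K₂ > 0` — the
  Gaussian integral «(3.183) … with the δ-function δ(Q̃A) replaced by exp[−½⟨Q̃A, aQ̃A⟩]» HAS a covariance; (iii) `G₂ = K₂⁻¹ > 0`; (iv)–(v) both members of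
  (3.138) for `G₂`; (vi) `G₂` has the block majorant `B_G(1 − B_Gc_Wmc²)⁻¹e^{−(δ₁−3σ)d}` — «the same properties», constants and rate adjusted.
* §5 THE LETTERS FROM THE PRINTED OBJECTS (abstract norms + matrix identities): `hasMaj_lam_of_3184` + `mulVecLin_lamMatrix` («more regular, as it follows
  easily from (3.184)»: `Λ̃`'s majorant `C_Λe^{−ρd}` from `H′`, `C′⁽ᵏ⁾(Λ)`, `H′ᵀΔ`, `(1 − R̃)Dᵀ`, `μ`, `Q`, `Q′`, `G̃′R̃Dᵀ`), `hasMaj_E_of_3117_3137` + `mulVecLin_E`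
  and `hasMaj_Et_of_3117_3137` + `mulVecLin_Et` (`(Δ + Δ⁽²⁾)D = ΔD + Δ⁽²⁾∘D`, `Dᵀ(Δ + Δ⁽²⁾) = DᵀΔ + Dᵀ∘Δ⁽²⁾`: small factor `m` from the (3.117) letters
  `c_J·m`, `c_J′·m` and the (3.137) letter `c₂·m`), `hasMaj_P_of_letters` + `mulVecLin_P` (`P = Q + D̄μQ`).

HONEST SCOPE / NOT CLAIMED.  (i) INPUTS of printed shape, not derived here: Theorem 3.12 for the (3.128)-type operator `G₁♮` (positivity + sup block
majorant; row B9.Thm3.12 — by reference to [4], G-B9-07/10); the (3.117)+(3.36) letters `ΔD`, `DᵀΔ` (row B9.Eq3.117, `B9Eq3117Current` on the lattice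
calculus — content not re-derived at matrix level, as in FILE 82); the (3.137) letter for `Δ⁽²⁾` (row B9.Eq3.137, `B9Ineq3137Regular`); the size `c_J·Mα₀`
of the `J`-form `𝒥` of `⟨H₁D̃⁽²⁾(·), J⟩` ((3.36), (3.133), p. 427 — D̃⁽²⁾ is not a typed object of the tree: C-B9-57 residual (ii)); the regular letters
`H′`, `C′⁽ᵏ⁾(Λ)`, `H′ᵀΔ`, `P̃Dᵀ`, `μ`, `Q`, `Q′`, `G̃′R̃Dᵀ`, `T̃` (Theorems 3.1/3.2, (3.49), (3.169), (3.174), (3.177)).  (ii) NOT the random-walk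
EXPANSION of `G₂` (G-B9-10 (b): replacing each letter by its walk expansion, Theorem 3.10's tree-graph bookkeeping p. 427) nor the kernel `(L^{j′}η)^{−d}`
form: the module delivers the sup block majorant / positivity / Neumann convergence — the (3.138)-level content of «in the same way»; the passage to
`Hyp3185`'s kernel bound of `QG̃₂Q*` is (3.186) (`B9Thm315Decay.kernel_3186`, needing also `(Q̃G₂Q̃*)⁻¹` «analyzed in the same way as (Q′G′²Q′\*)⁻¹»,
p. 422 — a further by-reference input, not typed here) and the majorant ⇒ kernel dictionary (`B6RandomWalkKernel`).  (iii) CURRENCY CAVEAT as in r06 FILES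
78–83 (cell GAPS C-pv21g2-1): between sharp-block SUP sizes the derivative letters `D`, `Dᵀ` and the Hessian hide scale weights that print carries as
`|D*A|`-terms / Hölder sizes ((3.131), (3.43)); one finite lattice at a time; explicit, crude, unoptimised constants.  (iv) Reading (b): `G₁♮` vs the wavy
`G̃₁` — located, not resolved.  NOT summit progress; N06 is NOT discharged by this file.

RELATED IN THE TREE, NOT DUPLICATED (searched 2026-08-26: `lean search` for `G₂`, `G̃₂`, `3.186`, `K3183` — hits only `B9Eq3185` ((3.183) ⇒ (3.185), `K3183`,
`eq_3185_via_G2`), `B9SectECov.eq_3186_scalar`, `B9Thm315Decay.kernel_3186` (kernel bookkeeping of (3.186) from FOUR kernel-bound hypotheses), B10's (63)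
readers `B10Eq63Rep`/`B10LogDet63`/`B10Eq63WalkUniform` («G̃₃(x) has the same properties as G̃₂» by analogy); none types the G₂ − G₁ terms).  USED BY NAME:
`B9Eq3185.K3183`, `B9Eq3184.lamT`/`aPrime`, `B9Thm312Positivity.expansion_posDef`/`linfty_opNorm_le_of_rowSums`/`rowSum_le_of_hasMaj_exp`,
`B9Eq3130Neumann.eq3130_hasSum`, `B11SectG.hasMaj_comp_exp`/`neumann_majorant`/`HasMaj.add/.neg/.mono/.congr/.of_rate_le`, `B9Thm37AllNorms.exists_hasMaj_const_ofBlocks`.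
Unit `pub-ymgap-dag-n06-b` (g2), HOME `run/shared/lean/pub/pub-ymgap/`; `--supports stmt-QuantumFields-19183`.

v1.1 (g2, APPEND-ONLY over v1 p416682 ✓; every v1 declaration byte-identical): §6 BRIDGE — `RDt_transpose_mul_RDt` (`(R̃Dᵀ)ᵀ(R̃Dᵀ) = DR̃Dᵀ`, `R` symmetric
idempotent: `B9SectECov.R_transpose`/`R_mul_R`), **`K1_eq_Ginv`** / `K1_eq_G1inv` (the (3.128)-type `G₁♮⁻¹` at p10's letters `R̃D* := R·Dᵀ`,
`T̃ := B9SectDFP.tOp` IS `B9SectDFP.Ginv W₀ …` = `B9Eq3152.G1inv K 𝒞 …` for `W₀ = K − 2𝒞` — so `hK₁`/`hG₁` of §3/§4 are r06 FILES 80–83's theorems BY NAME),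
`K2_eq_Ginv_add_newTerms` (`G₂⁻¹ = Ginv W₀ … + W_new`).
-/

noncomputable section

open scoped BigOperators Matrix

namespace Literature.MathematicalPhysics.QuantumFieldTheory.Balaban1983to89.B9Eq3186G2Perturbation

open Literature.MathematicalPhysics.QuantumFieldTheory.Balaban1983to89
open B11SectG B6RandomWalk

/-! ## §1 The algebra: `G₂⁻¹ − G₁♮⁻¹` = the `J`-word + the three `Dλ̃`-words -/

section Algebra

variable {b n b₁ r τ m : Type*} [Fintype b] [Fintype n] [Fintype b₁] [Fintype r] [Fintype τ] [Fintype m]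

/-- the quadratic form `⟨TA, W₀TA⟩` of a configuration map `T = T̃ + DΛ̃` expanded: `TᵀW₀T = T̃ᵀW₀T̃ + [T̃ᵀ(W₀D)Λ̃ + Λ̃ᵀ(DᵀW₀)T̃ +
Λ̃ᵀ(DᵀW₀)(DΛ̃)]` — the «terms containing Dλ̃(A)», each written with the letter `W₀D` or `DᵀW₀` exposed.
[cite: Balaban1985BackgroundPropagators, (3.183) p.432, (3.128) p.421] -/
theorem config_transpose_mul_expand (W₀ Tw : Matrix b b ℝ) (D : Matrix b n ℝ) (Lam : Matrix n b ℝ) :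
    (Tw + D * Lam)ᵀ * W₀ * (Tw + D * Lam) =
      Twᵀ * W₀ * Tw + (Twᵀ * (W₀ * D) * Lam + Lamᵀ * (Dᵀ * W₀) * Tw + Lamᵀ * (Dᵀ * W₀) * (D * Lam)) := by
  rw [Matrix.transpose_add, Matrix.transpose_mul]
  simp only [Matrix.add_mul, Matrix.mul_add, Matrix.mul_assoc]
  abel

/-- **«The operator G₂ differs from G₁ only by the small and regular operators connected with the second term in the exponential in (3.183), and
with terms containing Dλ̃(A)»** — EXACT, at the matrix level of `B9Eq3185`: `G₂⁻¹ = K₃₁₈₃(R̃D*, 𝒥, P, W₀, T̃ + DΛ̃) + aQ̃ᵀQ̃` minus the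
(3.128)-type `G₁♮⁻¹ = (R̃D*)ᵀ(R̃D*) + T̃ᵀW₀T̃ + aQ̃ᵀQ̃` is `−2Pᵀ𝒥P` (the second term of the exponent) plus `T̃ᵀ(W₀D)Λ̃ + Λ̃ᵀ(DᵀW₀)T̃ + Λ̃ᵀ(DᵀW₀)(DΛ̃)`
(the terms containing `DΛ̃`). [cite: Balaban1985BackgroundPropagators, p.432 (after (3.186)), (3.183) p.432, (3.128) p.421] -/
theorem K2_sub_K1 [DecidableEq b] (RDt : Matrix r b ℝ) (𝒥 : Matrix b₁ b₁ ℝ) (P : Matrix b₁ b ℝ) (W₀ Tw : Matrix b b ℝ)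
    (D : Matrix b n ℝ) (Lam : Matrix n b ℝ) (Qt : Matrix τ b ℝ) (a : ℝ) :
    (B9Eq3185.K3183 RDt 𝒥 P W₀ (Tw + D * Lam) + a • (Qtᵀ * Qt)) -
        (RDtᵀ * RDt + Twᵀ * W₀ * Tw + a • (Qtᵀ * Qt)) =
      -((2 : ℝ) • (Pᵀ * 𝒥 * P)) +
        (Twᵀ * (W₀ * D) * Lam + Lamᵀ * (Dᵀ * W₀) * Tw + Lamᵀ * (Dᵀ * W₀) * (D * Lam)) := by
  unfold B9Eq3185.K3183
  rw [config_transpose_mul_expand]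
  abel

/-- the new terms `W_new = −2Pᵀ𝒥P + T̃ᵀ(W₀D)Λ̃ + Λ̃ᵀ(DᵀW₀)T̃ + Λ̃ᵀ(DᵀW₀)(DΛ̃)` are SYMMETRIC when `𝒥` and `W₀ = Δ + Δ⁽²⁾` are (only the symmetric
parts of the forms of (3.183) matter). [cite: Balaban1985BackgroundPropagators, p.432 (after (3.186))] -/
theorem Wnew_transpose (𝒥 : Matrix b₁ b₁ ℝ) (h𝒥 : 𝒥ᵀ = 𝒥) (P : Matrix b₁ b ℝ) (W₀ Tw : Matrix b b ℝ)
    (hW₀ : W₀ᵀ = W₀) (D : Matrix b n ℝ) (Lam : Matrix n b ℝ) :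
    (-((2 : ℝ) • (Pᵀ * 𝒥 * P)) +
        (Twᵀ * (W₀ * D) * Lam + Lamᵀ * (Dᵀ * W₀) * Tw + Lamᵀ * (Dᵀ * W₀) * (D * Lam)))ᵀ =
      -((2 : ℝ) • (Pᵀ * 𝒥 * P)) +
        (Twᵀ * (W₀ * D) * Lam + Lamᵀ * (Dᵀ * W₀) * Tw + Lamᵀ * (Dᵀ * W₀) * (D * Lam)) := by
  simp only [Matrix.transpose_add, Matrix.transpose_neg, Matrix.transpose_smul, Matrix.transpose_mul,
    Matrix.transpose_transpose, h𝒥, hW₀, Matrix.mul_assoc]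
  abel

/-- the (3.128)-type operator `G₁♮⁻¹ = (R̃D*)ᵀ(R̃D*) + T̃ᵀW₀T̃ + aQ̃ᵀQ̃` is symmetric for symmetric `W₀`.
[cite: Balaban1985BackgroundPropagators, (3.128) p.421, (3.183) p.432] -/
theorem K1_transpose [DecidableEq b] (RDt : Matrix r b ℝ) (W₀ Tw : Matrix b b ℝ) (hW₀ : W₀ᵀ = W₀)
    (Qt : Matrix τ b ℝ) (a : ℝ) :
    (RDtᵀ * RDt + Twᵀ * W₀ * Tw + a • (Qtᵀ * Qt))ᵀ = RDtᵀ * RDt + Twᵀ * W₀ * Tw + a • (Qtᵀ * Qt) := by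
  simp only [Matrix.transpose_add, Matrix.transpose_smul, Matrix.transpose_mul, Matrix.transpose_transpose, hW₀,
    Matrix.mul_assoc]

/-- **(3.184) as a matrix**: with `μ` a matrix `Mu`, this lineage's `B9Eq3184.lamT` IS `Λ̃·A` with
`Λ̃ = H′C′⁽ᵏ⁾(Λ)H′ᵀΔ(1 − R̃)Dᵀ + H′·Mu·Q + H′Q′G̃′R̃Dᵀ` (`P̃ = 1 − R̃`). [cite: Balaban1985BackgroundPropagators, (3.184) p.432] -/
theorem lamT_eq_mulVec [DecidableEq n] (D : Matrix b n ℝ) (Δs Gw Rw : Matrix n n ℝ) (Q : Matrix b₁ b ℝ)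
    (Qp : Matrix m n ℝ) (Hp : Matrix n m ℝ) (Cp : Matrix m m ℝ) (Mu : Matrix m b₁ ℝ) (A : b → ℝ) :
    B9Eq3184.lamT D Δs Gw Rw Q Qp Hp Cp (Matrix.mulVecLin Mu) A =
      (Hp * Cp * Hpᵀ * Δs * (1 - Rw) * Dᵀ + Hp * Mu * Q + Hp * Qp * Gw * Rw * Dᵀ) *ᵥ A := by
  unfold B9Eq3184.lamT
  simp only [Matrix.add_mulVec, Matrix.mulVecLin_apply, Matrix.mulVec_mulVec, Matrix.mul_assoc]

/-- **the configuration of (3.183) as a matrix**: `A − DG̃′R̃D*A + Dλ̃(A) = (T̃ + DΛ̃)A` with `T̃ = 1 − DG̃′R̃Dᵀ` — `B9Eq3184.aPrime` and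
`B9Eq3184.lamT` by name; so the `T` of `B9Eq3185.K3183`/`genFun_3183` is `T̃ + DΛ̃` and §1 applies to the literal (3.183).
[cite: Balaban1985BackgroundPropagators, (3.183)–(3.184) p.432] -/
theorem config3183_eq_mulVec [DecidableEq n] [DecidableEq b] (D : Matrix b n ℝ) (Δs Gw Rw : Matrix n n ℝ)
    (Q : Matrix b₁ b ℝ) (Qp : Matrix m n ℝ) (Hp : Matrix n m ℝ) (Cp : Matrix m m ℝ) (Mu : Matrix m b₁ ℝ) (A : b → ℝ) :
    B9Eq3184.aPrime D Gw Rw A + D *ᵥ B9Eq3184.lamT D Δs Gw Rw Q Qp Hp Cp (Matrix.mulVecLin Mu) A =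
      ((1 - D * Gw * Rw * Dᵀ) +
        D * (Hp * Cp * Hpᵀ * Δs * (1 - Rw) * Dᵀ + Hp * Mu * Q + Hp * Qp * Gw * Rw * Dᵀ)) *ᵥ A := by
  rw [lamT_eq_mulVec]
  unfold B9Eq3184.aPrime
  simp only [Matrix.add_mulVec, Matrix.sub_mulVec, Matrix.one_mulVec, Matrix.mulVec_add, Matrix.mul_add,
    Matrix.mulVec_mulVec, Matrix.mul_assoc]

end Algebra

/-! ## §2 The block majorants of the new terms from the letters ([4] (2.52)–(2.55) + Lemma 2.1) -/

section Letters

variable {g : B6.Geometry} {FX FN FB FM : Type} [AddCommGroup FX] [Module ℝ FX] [AddCommGroup FN] [Module ℝ FN]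
  [AddCommGroup FB] [Module ℝ FB] [AddCommGroup FM] [Module ℝ FM]
variable {bX : BlockNorm g FX} {bN : BlockNorm g FN} {bB : BlockNorm g FB} {bM : BlockNorm g FM}

/-- **the `J`-word `Pᵀ𝒥P`** («the small and regular operators connected with the second term in the exponential in (3.183)»): `P : bX → bB`
(`C_Pe^{−δ₁d}`), the `J`-form `𝒥 : bB → bB` with the SMALL factor `m = Mα₀` (`c_J·m·e^{−δ₁d}`; (3.36)/(3.133)), `Pᵀ : bB → bX` (`C_P′e^{−δ₁d}`) ⟹
`Pᵀ𝒥P` has `κ_BC_P′(κ_Bc_JmC_Pc)c·e^{−ρd}` for `ρ + σ ≦ δ₁`. [cite: Balaban1985BackgroundPropagators, p.432 (after (3.186))] [cite: Balaban1984PropagatorsII, (2.52)–(2.55) p.232, (2.61) p.234] -/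
theorem hasMaj_Jword {Jf : FB →ₗ[ℝ] FB} {Pf : FX →ₗ[ℝ] FB} {Ptf : FB →ₗ[ℝ] FX} {cJ m CP CP' δ₁ ρ σ c : ℝ}
    (htri : Triangle254 g) (hd : ∀ a b : g.Site, 0 ≤ g.dist a b) (hrow : RowSum g σ c) (hc0 : 0 ≤ c)
    (hcJ : 0 ≤ cJ) (hm : 0 ≤ m) (hCP : 0 ≤ CP) (hCP' : 0 ≤ CP') (hρ : 0 ≤ ρ) (hσ : 0 ≤ σ) (hρδ : ρ + σ ≤ δ₁)
    (hJ : HasMaj bB bB Jf (fun a b => cJ * m * Real.exp (-(δ₁ * g.dist a b))))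
    (hP : HasMaj bX bB Pf (fun a b => CP * Real.exp (-(δ₁ * g.dist a b))))
    (hPt : HasMaj bB bX Ptf (fun a b => CP' * Real.exp (-(δ₁ * g.dist a b)))) :
    HasMaj bX bX (Ptf ∘ₗ (Jf ∘ₗ Pf))
      (fun a b => bB.κ * CP' * (bB.κ * (cJ * m) * CP * c) * c * Real.exp (-(ρ * g.dist a b))) := by
  have h1 : HasMaj bX bB (Jf ∘ₗ Pf) (fun a b => bB.κ * (cJ * m) * CP * c * Real.exp (-(ρ * g.dist a b))) :=
    hasMaj_comp_exp htri hd hrow (mul_nonneg hcJ hm) hCP hρ (by linarith) hρδ hJ hP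
  exact hasMaj_comp_exp htri hd hrow hCP'
    (mul_nonneg (mul_nonneg (mul_nonneg bB.κ_nonneg (mul_nonneg hcJ hm)) hCP) hc0) hρ le_rfl hρδ hPt h1

/-- **the word `T̃ᵀ(W₀D)Λ̃`** (a «term containing Dλ̃(A)»): `Λ̃ : bX → bN` regular (`C_Λ`), the gauge-variation letter `W₀D = (Δ + Δ⁽²⁾)D : bN → bX`
SMALL (`c_E·m`; (3.117)+(3.36), (3.137)), `T̃ᵀ : bX → bX` regular (`C_T′`) ⟹ `κ_XC_T′(κ_Nc_EmC_Λc)c·e^{−ρd}`.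
[cite: Balaban1985BackgroundPropagators, p.432 (after (3.186))] [cite: Balaban1985BackgroundPropagators, (3.117) p.419, (3.137) p.423] [cite: Balaban1984PropagatorsII, (2.52)–(2.55) p.232, (2.61) p.234] -/
theorem hasMaj_word2 {Ef : FN →ₗ[ℝ] FX} {Lf : FX →ₗ[ℝ] FN} {Twtf : FX →ₗ[ℝ] FX} {cE m CL CT' δ₁ ρ σ c : ℝ}
    (htri : Triangle254 g) (hd : ∀ a b : g.Site, 0 ≤ g.dist a b) (hrow : RowSum g σ c) (hc0 : 0 ≤ c)
    (hcE : 0 ≤ cE) (hm : 0 ≤ m) (hCL : 0 ≤ CL) (hCT' : 0 ≤ CT') (hρ : 0 ≤ ρ) (hσ : 0 ≤ σ) (hρδ : ρ + σ ≤ δ₁)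
    (hE : HasMaj bN bX Ef (fun a b => cE * m * Real.exp (-(δ₁ * g.dist a b))))
    (hL : HasMaj bX bN Lf (fun a b => CL * Real.exp (-(δ₁ * g.dist a b))))
    (hTwt : HasMaj bX bX Twtf (fun a b => CT' * Real.exp (-(δ₁ * g.dist a b)))) :
    HasMaj bX bX (Twtf ∘ₗ (Ef ∘ₗ Lf))
      (fun a b => bX.κ * CT' * (bN.κ * (cE * m) * CL * c) * c * Real.exp (-(ρ * g.dist a b))) := by
  have h1 : HasMaj bX bX (Ef ∘ₗ Lf) (fun a b => bN.κ * (cE * m) * CL * c * Real.exp (-(ρ * g.dist a b))) :=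
    hasMaj_comp_exp htri hd hrow (mul_nonneg hcE hm) hCL hρ (by linarith) hρδ hE hL
  exact hasMaj_comp_exp htri hd hrow hCT'
    (mul_nonneg (mul_nonneg (mul_nonneg bN.κ_nonneg (mul_nonneg hcE hm)) hCL) hc0) hρ le_rfl hρδ hTwt h1

/-- **the word `Λ̃ᵀ(DᵀW₀)T̃`**: `T̃ : bX → bX` (`C_T`), `DᵀW₀ = Dᵀ(Δ + Δ⁽²⁾) : bX → bN` SMALL (`c_E′·m`), `Λ̃ᵀ : bN → bX` (`C_Λ′`) ⟹
`κ_NC_Λ′(κ_Xc_E′mC_Tc)c·e^{−ρd}`. [cite: Balaban1985BackgroundPropagators, p.432 (after (3.186))] [cite: Balaban1985BackgroundPropagators, (3.117) p.419] [cite: Balaban1984PropagatorsII, (2.52)–(2.55) p.232, (2.61) p.234] -/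
theorem hasMaj_word3 {Etf : FX →ₗ[ℝ] FN} {Ltf : FN →ₗ[ℝ] FX} {Twf : FX →ₗ[ℝ] FX} {cE' m CL' CT δ₁ ρ σ c : ℝ}
    (htri : Triangle254 g) (hd : ∀ a b : g.Site, 0 ≤ g.dist a b) (hrow : RowSum g σ c) (hc0 : 0 ≤ c)
    (hcE' : 0 ≤ cE') (hm : 0 ≤ m) (hCL' : 0 ≤ CL') (hCT : 0 ≤ CT) (hρ : 0 ≤ ρ) (hσ : 0 ≤ σ) (hρδ : ρ + σ ≤ δ₁)
    (hEt : HasMaj bX bN Etf (fun a b => cE' * m * Real.exp (-(δ₁ * g.dist a b))))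
    (hLt : HasMaj bN bX Ltf (fun a b => CL' * Real.exp (-(δ₁ * g.dist a b))))
    (hTw : HasMaj bX bX Twf (fun a b => CT * Real.exp (-(δ₁ * g.dist a b)))) :
    HasMaj bX bX (Ltf ∘ₗ (Etf ∘ₗ Twf))
      (fun a b => bN.κ * CL' * (bX.κ * (cE' * m) * CT * c) * c * Real.exp (-(ρ * g.dist a b))) := by
  have h1 : HasMaj bX bN (Etf ∘ₗ Twf) (fun a b => bX.κ * (cE' * m) * CT * c * Real.exp (-(ρ * g.dist a b))) :=
    hasMaj_comp_exp htri hd hrow (mul_nonneg hcE' hm) hCT hρ (by linarith) hρδ hEt hTw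
  exact hasMaj_comp_exp htri hd hrow hCL'
    (mul_nonneg (mul_nonneg (mul_nonneg bX.κ_nonneg (mul_nonneg hcE' hm)) hCT) hc0) hρ le_rfl hρδ hLt h1

/-- **the word `Λ̃ᵀ(DᵀW₀)DΛ̃`**: `Λ̃ : bX → bN` (`C_Λ`), `D : bN → bX` (`C_D`), `DᵀW₀ : bX → bN` SMALL (`c_E′·m`), `Λ̃ᵀ : bN → bX` (`C_Λ′`) ⟹
`κ_NC_Λ′(κ_Xc_E′m(κ_NC_DC_Λc)c)c·e^{−ρd}`. [cite: Balaban1985BackgroundPropagators, p.432 (after (3.186))] [cite: Balaban1984PropagatorsII, (2.52)–(2.55) p.232, (2.61) p.234] -/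
theorem hasMaj_word4 {Etf : FX →ₗ[ℝ] FN} {Ltf : FN →ₗ[ℝ] FX} {Df : FN →ₗ[ℝ] FX} {Lf : FX →ₗ[ℝ] FN}
    {cE' m CL CL' CD δ₁ ρ σ c : ℝ}
    (htri : Triangle254 g) (hd : ∀ a b : g.Site, 0 ≤ g.dist a b) (hrow : RowSum g σ c) (hc0 : 0 ≤ c)
    (hcE' : 0 ≤ cE') (hm : 0 ≤ m) (hCL : 0 ≤ CL) (hCL' : 0 ≤ CL') (hCD : 0 ≤ CD) (hρ : 0 ≤ ρ) (hσ : 0 ≤ σ)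
    (hρδ : ρ + σ ≤ δ₁)
    (hEt : HasMaj bX bN Etf (fun a b => cE' * m * Real.exp (-(δ₁ * g.dist a b))))
    (hLt : HasMaj bN bX Ltf (fun a b => CL' * Real.exp (-(δ₁ * g.dist a b))))
    (hD : HasMaj bN bX Df (fun a b => CD * Real.exp (-(δ₁ * g.dist a b))))
    (hL : HasMaj bX bN Lf (fun a b => CL * Real.exp (-(δ₁ * g.dist a b)))) :
    HasMaj bX bX (Ltf ∘ₗ (Etf ∘ₗ (Df ∘ₗ Lf)))
      (fun a b => bN.κ * CL' * (bX.κ * (cE' * m) * (bN.κ * CD * CL * c) * c) * c * Real.exp (-(ρ * g.dist a b))) := by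
  have h1 : HasMaj bX bX (Df ∘ₗ Lf) (fun a b => bN.κ * CD * CL * c * Real.exp (-(ρ * g.dist a b))) :=
    hasMaj_comp_exp htri hd hrow hCD hCL hρ (by linarith) hρδ hD hL
  have h1c : 0 ≤ bN.κ * CD * CL * c := mul_nonneg (mul_nonneg (mul_nonneg bN.κ_nonneg hCD) hCL) hc0
  have h2 : HasMaj bX bN (Etf ∘ₗ (Df ∘ₗ Lf))
      (fun a b => bX.κ * (cE' * m) * (bN.κ * CD * CL * c) * c * Real.exp (-(ρ * g.dist a b))) :=
    hasMaj_comp_exp htri hd hrow (mul_nonneg hcE' hm) h1c hρ le_rfl hρδ hEt h1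
  exact hasMaj_comp_exp htri hd hrow hCL'
    (mul_nonneg (mul_nonneg (mul_nonneg bX.κ_nonneg (mul_nonneg hcE' hm)) h1c) hc0) hρ le_rfl hρδ hLt h2

/-- **«small and regular»: THE BLOCK MAJORANT OF THE NEW TERMS** `W_new = −(Pᵀ𝒥P + Pᵀ𝒥P) + [T̃ᵀ(W₀D)Λ̃ + Λ̃ᵀ(DᵀW₀)T̃ + Λ̃ᵀ(DᵀW₀)DΛ̃]` from the
ten letters: `c_W·m·e^{−ρd}` with `c_W = 2κ_B²C_P′c_JC_Pc² + κ_Xκ_NC_T′c_EC_Λc² + κ_Nκ_XC_Λ′c_E′C_Tc² + κ_N²κ_XC_Λ′c_E′C_DC_Λc³` — exactly ONE small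
factor `m = Mα₀` in every summand, exponential shape, `ρ + σ ≦ δ₁` («A summation preserves it also»).
[cite: Balaban1985BackgroundPropagators, p.432 (after (3.186))] [cite: Balaban1985BackgroundPropagators, (3.117) p.419, (3.137) p.423] [cite: Balaban1984PropagatorsII, (2.52)–(2.55) p.232, (2.61) p.234] -/
theorem hasMaj_newTerms {Jf : FB →ₗ[ℝ] FB} {Pf : FX →ₗ[ℝ] FB} {Ptf : FB →ₗ[ℝ] FX} {Ef : FN →ₗ[ℝ] FX}
    {Etf : FX →ₗ[ℝ] FN} {Twf Twtf : FX →ₗ[ℝ] FX} {Lf : FX →ₗ[ℝ] FN} {Ltf : FN →ₗ[ℝ] FX} {Df : FN →ₗ[ℝ] FX}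
    {cJ cE cE' m CP CP' CT CT' CL CL' CD δ₁ ρ σ c : ℝ}
    (htri : Triangle254 g) (hd : ∀ a b : g.Site, 0 ≤ g.dist a b) (hrow : RowSum g σ c) (hc0 : 0 ≤ c)
    (hcJ : 0 ≤ cJ) (hcE : 0 ≤ cE) (hcE' : 0 ≤ cE') (hm : 0 ≤ m) (hCP : 0 ≤ CP) (hCP' : 0 ≤ CP') (hCT : 0 ≤ CT)
    (hCT' : 0 ≤ CT') (hCL : 0 ≤ CL) (hCL' : 0 ≤ CL') (hCD : 0 ≤ CD) (hρ : 0 ≤ ρ) (hσ : 0 ≤ σ) (hρδ : ρ + σ ≤ δ₁)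
    (hJ : HasMaj bB bB Jf (fun a b => cJ * m * Real.exp (-(δ₁ * g.dist a b))))
    (hP : HasMaj bX bB Pf (fun a b => CP * Real.exp (-(δ₁ * g.dist a b))))
    (hPt : HasMaj bB bX Ptf (fun a b => CP' * Real.exp (-(δ₁ * g.dist a b))))
    (hE : HasMaj bN bX Ef (fun a b => cE * m * Real.exp (-(δ₁ * g.dist a b))))
    (hEt : HasMaj bX bN Etf (fun a b => cE' * m * Real.exp (-(δ₁ * g.dist a b))))
    (hTw : HasMaj bX bX Twf (fun a b => CT * Real.exp (-(δ₁ * g.dist a b))))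
    (hTwt : HasMaj bX bX Twtf (fun a b => CT' * Real.exp (-(δ₁ * g.dist a b))))
    (hL : HasMaj bX bN Lf (fun a b => CL * Real.exp (-(δ₁ * g.dist a b))))
    (hLt : HasMaj bN bX Ltf (fun a b => CL' * Real.exp (-(δ₁ * g.dist a b))))
    (hD : HasMaj bN bX Df (fun a b => CD * Real.exp (-(δ₁ * g.dist a b)))) :
    HasMaj bX bX
      (-(Ptf ∘ₗ (Jf ∘ₗ Pf) + Ptf ∘ₗ (Jf ∘ₗ Pf)) +
        (Twtf ∘ₗ (Ef ∘ₗ Lf) + Ltf ∘ₗ (Etf ∘ₗ Twf) + Ltf ∘ₗ (Etf ∘ₗ (Df ∘ₗ Lf))))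
      (fun a b =>
        (2 * (bB.κ * CP' * bB.κ * cJ * CP * c * c) + bX.κ * CT' * bN.κ * cE * CL * c * c +
            bN.κ * CL' * bX.κ * cE' * CT * c * c + bN.κ * CL' * bX.κ * cE' * bN.κ * CD * CL * c * c * c) *
          m * Real.exp (-(ρ * g.dist a b))) := by
  have hJw := hasMaj_Jword htri hd hrow hc0 hcJ hm hCP hCP' hρ hσ hρδ hJ hP hPt
  have h2 := hasMaj_word2 htri hd hrow hc0 hcE hm hCL hCT' hρ hσ hρδ hE hL hTwt
  have h3 := hasMaj_word3 htri hd hrow hc0 hcE' hm hCL' hCT hρ hσ hρδ hEt hLt hTw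
  have h4 := hasMaj_word4 htri hd hrow hc0 hcE' hm hCL hCL' hCD hρ hσ hρδ hEt hLt hD hL
  exact (((hJw.add hJw).neg).add ((h2.add h3).add h4)).mono fun a b => le_of_eq (by ring)

end Letters

/-! ## §3 «In the same way as the operator G₁ in (3.138)»: the resolvent step `G₂ = G₁♮(1 + WG₁♮)⁻¹` -/

section Resolvent

open scoped Matrix.Norms.Operator

variable {g : B6.Geometry} {b : Type} [Fintype b] [DecidableEq b]

omit [DecidableEq b] in
/-- **block majorants ⟹ the row-sum letter of the Neumann series**: on the sharp-block sup sizes (κ = 1), `G` with `B_Ge^{−δ₁d}` and `W` with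
`c_Wme^{−δ₁d}`, `2σ ≦ δ₁` ⟹ the row sums of `|WG|` are `≦ B_G(c_Wm)c²` (composition at the rate `σ`, then [4] (2.61) at `σ`;
`B9Thm312Positivity.rowSum_le_of_hasMaj_exp`). [cite: Balaban1985BackgroundPropagators, (3.138) p.423, p.432 (after (3.186))] [cite: Balaban1984PropagatorsII, (2.52)–(2.55) p.232, (2.61) p.234] -/
theorem rowSums_mul_le (blk : b → g.Site) (G W : Matrix b b ℝ) {BG cW m δ₁ σ c : ℝ}
    (htri : Triangle254 g) (hd : ∀ a b : g.Site, 0 ≤ g.dist a b) (hrow : RowSum g σ c) (hc0 : 0 ≤ c)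
    (hBG : 0 ≤ BG) (hcW : 0 ≤ cW) (hm : 0 ≤ m) (hσ : 0 ≤ σ) (hσδ : σ + σ ≤ δ₁)
    (hG : HasMaj (BlockNorm.ofBlocks g blk) (BlockNorm.ofBlocks g blk) (Matrix.mulVecLin G)
      (fun a b => BG * Real.exp (-(δ₁ * g.dist a b))))
    (hW : HasMaj (BlockNorm.ofBlocks g blk) (BlockNorm.ofBlocks g blk) (Matrix.mulVecLin W)
      (fun a b => cW * m * Real.exp (-(δ₁ * g.dist a b)))) :
    ∀ i, ∑ j, |(W * G) i j| ≤ BG * (cW * m) * c * c := by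
  have hcomp : HasMaj (BlockNorm.ofBlocks g blk) (BlockNorm.ofBlocks g blk) (Matrix.mulVecLin (W * G))
      (fun a b => (BlockNorm.ofBlocks g blk).κ * (cW * m) * BG * c * Real.exp (-(σ * g.dist a b))) := by
    rw [Matrix.mulVecLin_mul]
    exact hasMaj_comp_exp htri hd hrow (mul_nonneg hcW hm) hBG hσ (by linarith) hσδ hW hG
  have hκ : (BlockNorm.ofBlocks g blk).κ = 1 := rfl
  rw [hκ, one_mul] at hcomp
  intro i
  refine (B9Thm312Positivity.rowSum_le_of_hasMaj_exp blk (W * G)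
    (mul_nonneg (mul_nonneg (mul_nonneg hcW hm) hBG) hc0) hrow hcomp i).trans_eq (by ring)

/-- **«Thus we can investigate the operator G₂ perturbatively in the same way as the operator G₁ in (3.138)»** — the (3.138) step BY NAME for an
arbitrary symmetric positive `K₁ = G₁♮⁻¹` and symmetric perturbation `W` on the sharp blocks: `G₁♮` with majorant `B_Ge^{−δ₁d}` (Theorem 3.12-type
input), `W` with `c_Wme^{−δ₁d}` (§2), `2σ ≦ δ₁`, and «Mα₀ sufficiently small»: `B_G·c_W·m·c² < 1` ⟹ `I + WG₁♮` is invertible; `G₂ := G₁♮(I + WG₁♮)⁻¹`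
is a two-sided inverse of `K₁ + W`, `= (K₁ + W)⁻¹`, symmetric, POSITIVE DEFINITE; `G₂⁻¹ = K₁ + W` is positive definite; and the series
`Σₙ G₁♮(−WG₁♮)ⁿ` converges to `G₂` in the sup operator norm — `B9Thm312Positivity.expansion_posDef` (Theorem 3.11's positivity step for (3.138)) and
`B9Eq3130Neumann.eq3130_hasSum` ((3.130) in a normed ring) at `G₀ := G₁♮`, `Δ′_π := −W`.
[cite: Balaban1985BackgroundPropagators, p.432 (after (3.186)), (3.138) p.423, (3.130) p.421, Thm 3.12 p.423, Thm 3.11 p.416] [cite: Balaban1984PropagatorsII, (2.52)–(2.55) p.232, (2.61) p.234] -/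
theorem g2_expansion (blk : b → g.Site) (K₁ W : Matrix b b ℝ) (hK₁ : K₁.PosDef) (hWt : Wᵀ = W)
    {BG cW m δ₁ σ c : ℝ}
    (htri : Triangle254 g) (hd : ∀ a b : g.Site, 0 ≤ g.dist a b) (hrow : RowSum g σ c) (hc0 : 0 ≤ c)
    (hBG : 0 ≤ BG) (hcW : 0 ≤ cW) (hm : 0 ≤ m) (hσ : 0 ≤ σ) (hσδ : σ + σ ≤ δ₁)
    (hG₁ : HasMaj (BlockNorm.ofBlocks g blk) (BlockNorm.ofBlocks g blk) (Matrix.mulVecLin K₁⁻¹)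
      (fun a b => BG * Real.exp (-(δ₁ * g.dist a b))))
    (hW : HasMaj (BlockNorm.ofBlocks g blk) (BlockNorm.ofBlocks g blk) (Matrix.mulVecLin W)
      (fun a b => cW * m * Real.exp (-(δ₁ * g.dist a b))))
    (hsmall : BG * (cW * m) * c * c < 1) :
    IsUnit (1 + W * K₁⁻¹) ∧
    (K₁ + W) * (K₁⁻¹ * (1 + W * K₁⁻¹)⁻¹) = 1 ∧
    K₁⁻¹ * (1 + W * K₁⁻¹)⁻¹ * (K₁ + W) = 1 ∧
    (K₁⁻¹ * (1 + W * K₁⁻¹)⁻¹)ᵀ = K₁⁻¹ * (1 + W * K₁⁻¹)⁻¹ ∧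
    (K₁⁻¹ * (1 + W * K₁⁻¹)⁻¹).PosDef ∧
    (K₁ + W).PosDef ∧
    (K₁ + W)⁻¹ = K₁⁻¹ * (1 + W * K₁⁻¹)⁻¹ ∧
    HasSum (fun k : ℕ => K₁⁻¹ * ((-W) * K₁⁻¹) ^ k) (K₁⁻¹ * (1 + W * K₁⁻¹)⁻¹) := by
  have hG0 : K₁⁻¹.PosDef := hK₁.inv
  have hTp : (-W)ᵀ = -W := by rw [Matrix.transpose_neg, hWt]
  have hrowW : ∀ i, ∑ j, |((-W) * K₁⁻¹) i j| ≤ BG * (cW * m) * c * c := by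
    intro i
    have h := rowSums_mul_le blk K₁⁻¹ W htri hd hrow hc0 hBG hcW hm hσ hσδ hG₁ hW i
    simpa only [Matrix.neg_mul, Matrix.neg_apply, abs_neg] using h
  have hρ0 : 0 ≤ BG * (cW * m) * c * c :=
    mul_nonneg (mul_nonneg (mul_nonneg hBG (mul_nonneg hcW hm)) hc0) hc0
  obtain ⟨hU, -, hleft, hright, hsymm, hpos⟩ :=
    B9Thm312Positivity.expansion_posDef K₁⁻¹ (-W) hG0 hTp hsmall hrowW
  have hK₁det : IsUnit K₁.det := (Matrix.isUnit_iff_isUnit_det _).mp hK₁.isUnit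
  have hinvinv : K₁⁻¹⁻¹ = K₁ := Matrix.nonsing_inv_nonsing_inv K₁ hK₁det
  have h1 : 1 - (-W) * K₁⁻¹ = 1 + W * K₁⁻¹ := by rw [Matrix.neg_mul, sub_neg_eq_add]
  have h2 : K₁⁻¹⁻¹ - (-W) = K₁ + W := by rw [hinvinv, sub_neg_eq_add]
  rw [h1] at hU hleft hright hsymm hpos
  rw [h2] at hleft hright
  have hinv : (K₁ + W)⁻¹ = K₁⁻¹ * (1 + W * K₁⁻¹)⁻¹ := Matrix.inv_eq_right_inv hleft
  have hK₂ : (K₁ + W).PosDef := by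
    have h3 : (K₁⁻¹ * (1 + W * K₁⁻¹)⁻¹)⁻¹ = K₁ + W := Matrix.inv_eq_left_inv hleft
    rw [← h3]
    exact hpos.inv
  -- the series, by r06 FILE 68's normed-ring statement of (3.130) at `Δ := K₁`, `Δ′_π := −W`, `G₀ := K₁⁻¹`
  have hn : ‖(-W) * K₁⁻¹‖ < 1 := (B9Thm312Positivity.linfty_opNorm_le_of_rowSums _ hρ0 hrowW).trans_lt hsmall
  have h₁ : (K₁ + 0 + 0) * K₁⁻¹ = 1 := by rw [add_zero, add_zero]; exact Matrix.mul_nonsing_inv _ hK₁det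
  have h₂ : K₁⁻¹ * (K₁ + 0 + 0) = 1 := by rw [add_zero, add_zero]; exact Matrix.nonsing_inv_mul _ hK₁det
  have key := B9Eq3130Neumann.eq3130_hasSum K₁ (0 : Matrix b b ℝ) 0 (-W) K₁⁻¹ h₁ h₂ hn
  rw [add_zero, add_zero, sub_neg_eq_add, ← Matrix.nonsing_inv_eq_ringInverse, hinv] at key
  exact ⟨hU, hleft, hright, hsymm, hpos, hK₂, hinv, key⟩

/-- **«the same properties»: THE BLOCK MAJORANT OF `G₂`** — for any `G₂` with `(K₁ + W)G₂ = I` (`K₁` invertible): the fixed point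
`G₂ = G₁♮ − G₁♮WG₂` with `K′ = −G₁♮W` of majorant `B_G(c_Wm)c·e^{−(δ₁−σ)d}`, r16's `B11SectG.neumann_majorant` («(188) and Lemma 2.1») and the finite-lattice
a-priori bound `B9Thm37AllNorms.exists_hasMaj_const_ofBlocks` give `G₂` the majorant `B_G(1 − B_Gc_Wmc²)⁻¹e^{−(δ₁−2σ)d}` — `G₁♮`'s exponential shape
with the constant and the rate adjusted. [cite: Balaban1985BackgroundPropagators, p.432 (after (3.186)), (3.138) p.423] [cite: Balaban1984PropagatorsII, (2.64)–(2.66) p.234, (2.61) p.234] -/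
theorem g2_majorant (blk : b → g.Site) (K₁ W G₂ : Matrix b b ℝ) (hK₁ : IsUnit K₁.det) (hG₂ : (K₁ + W) * G₂ = 1)
    {BG cW m δ₁ σ c : ℝ}
    (htri : Triangle254 g) (hd : ∀ a b : g.Site, 0 ≤ g.dist a b) (hrow : RowSum g σ c) (hc0 : 0 ≤ c)
    (hBG : 0 ≤ BG) (hcW : 0 ≤ cW) (hm : 0 ≤ m) (hσ : 0 ≤ σ) (hσδ : σ + σ ≤ δ₁)
    (hG₁ : HasMaj (BlockNorm.ofBlocks g blk) (BlockNorm.ofBlocks g blk) (Matrix.mulVecLin K₁⁻¹)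
      (fun a b => BG * Real.exp (-(δ₁ * g.dist a b))))
    (hW : HasMaj (BlockNorm.ofBlocks g blk) (BlockNorm.ofBlocks g blk) (Matrix.mulVecLin W)
      (fun a b => cW * m * Real.exp (-(δ₁ * g.dist a b))))
    (hsmall : BG * (cW * m) * c * c < 1) :
    HasMaj (BlockNorm.ofBlocks g blk) (BlockNorm.ofBlocks g blk) (Matrix.mulVecLin G₂)
      (fun a b => BG * (1 - BG * (cW * m) * c * c)⁻¹ * Real.exp (-((δ₁ - σ - σ) * g.dist a b))) := by
  have hκ : (BlockNorm.ofBlocks g blk).κ = 1 := rfl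
  -- the fixed-point form `G₂ = G₁♮ − G₁♮WG₂`
  have hmat : G₂ = K₁⁻¹ + (-(K₁⁻¹ * W)) * G₂ := by
    have h := congrArg (fun M => K₁⁻¹ * M) hG₂
    simp only [Matrix.mul_add, Matrix.add_mul, ← Matrix.mul_assoc, Matrix.nonsing_inv_mul _ hK₁, Matrix.one_mul,
      Matrix.mul_one] at h
    rw [Matrix.neg_mul, ← sub_eq_add_neg, eq_sub_iff_add_eq]
    exact h
  have hfix : Matrix.mulVecLin G₂ =
      Matrix.mulVecLin K₁⁻¹ + Matrix.mulVecLin (-(K₁⁻¹ * W)) ∘ₗ Matrix.mulVecLin G₂ := by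
    rw [← Matrix.mulVecLin_mul, ← Matrix.mulVecLin_add, ← hmat]
  -- the letter `K′ = −G₁♮W` at the rate `δ₁ − σ`
  have hK' : HasMaj (BlockNorm.ofBlocks g blk) (BlockNorm.ofBlocks g blk) (Matrix.mulVecLin (-(K₁⁻¹ * W)))
      (fun a b => 1 * BG * (cW * m) * c * Real.exp (-((δ₁ - σ) * g.dist a b))) := by
    have hc := hasMaj_comp_exp (ρ := δ₁ - σ) htri hd hrow hBG (mul_nonneg hcW hm) (by linarith) (by linarith)
      (by linarith) hG₁ hW
    rw [hκ, ← Matrix.mulVecLin_mul] at hc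
    exact hc.neg.congr fun μ => by simp
  have hS := hG₁.of_rate_le hd hBG (show δ₁ - σ - σ ≤ δ₁ by linarith)
  obtain ⟨M₀, hM₀, hap⟩ := B9Thm37AllNorms.exists_hasMaj_const_ofBlocks blk blk (Matrix.mulVecLin G₂)
  have hθ : 0 ≤ 1 * BG * (cW * m) * c := by
    rw [one_mul]; exact mul_nonneg (mul_nonneg hBG (mul_nonneg hcW hm)) hc0
  have hq : (BlockNorm.ofBlocks g blk).κ * (1 * BG * (cW * m) * c) * c < 1 := by
    rw [hκ, one_mul, one_mul]; exact hsmall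
  have h := neumann_majorant htri hd hrow hθ hBG hM₀ (by linarith) (by linarith) hK' hS hfix hap hq
  refine h.mono fun a b => le_of_eq ?_
  rw [hκ, one_mul, one_mul]

end Resolvent

/-! ## §4 END TO END at the letters of (3.183): `G₂ = (K₃₁₈₃ + aQ̃ᵀQ̃)⁻¹` «perturbatively in the same way as G₁» -/

section EndToEnd

variable {g : B6.Geometry} {b n b₁ r τ : Type} [Fintype b] [Fintype n] [Fintype b₁] [Fintype r] [Fintype τ]
  [DecidableEq b]

omit [Fintype r] [Fintype τ] [DecidableEq b] in
/-- the new terms of §1 ARE §2's word in the matrix letters `mulVecLin Pᵀ`, `mulVecLin 𝒥`, `mulVecLin P`, `mulVecLin T̃ᵀ`, `mulVecLin (W₀D)`,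
`mulVecLin Λ̃`, `mulVecLin Λ̃ᵀ`, `mulVecLin (DᵀW₀)`, `mulVecLin T̃`, `mulVecLin D` (`2X = X + X`: block norms are not homogeneous).
[cite: Balaban1985BackgroundPropagators, p.432 (after (3.186))] -/
theorem mulVecLin_newTerms (𝒥 : Matrix b₁ b₁ ℝ) (P : Matrix b₁ b ℝ) (W₀ Tw : Matrix b b ℝ) (D : Matrix b n ℝ)
    (Lam : Matrix n b ℝ) :
    Matrix.mulVecLin (-((2 : ℝ) • (Pᵀ * 𝒥 * P)) +
        (Twᵀ * (W₀ * D) * Lam + Lamᵀ * (Dᵀ * W₀) * Tw + Lamᵀ * (Dᵀ * W₀) * (D * Lam))) =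
      -(Matrix.mulVecLin Pᵀ ∘ₗ (Matrix.mulVecLin 𝒥 ∘ₗ Matrix.mulVecLin P) +
          Matrix.mulVecLin Pᵀ ∘ₗ (Matrix.mulVecLin 𝒥 ∘ₗ Matrix.mulVecLin P)) +
        (Matrix.mulVecLin Twᵀ ∘ₗ (Matrix.mulVecLin (W₀ * D) ∘ₗ Matrix.mulVecLin Lam) +
          Matrix.mulVecLin Lamᵀ ∘ₗ (Matrix.mulVecLin (Dᵀ * W₀) ∘ₗ Matrix.mulVecLin Tw) +
          Matrix.mulVecLin Lamᵀ ∘ₗ (Matrix.mulVecLin (Dᵀ * W₀) ∘ₗ (Matrix.mulVecLin D ∘ₗ Matrix.mulVecLin Lam))) := by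
  apply LinearMap.ext
  intro v
  simp only [Matrix.mulVecLin_apply, LinearMap.add_apply, LinearMap.neg_apply, LinearMap.comp_apply,
    Matrix.add_mulVec, Matrix.neg_mulVec, Matrix.mulVec_mulVec, Matrix.mul_assoc, two_smul]

/-- **G-B9-10 (a) END TO END AT THE LETTERS OF (3.183)** — «The operator G₂ differs from G₁ only by the small and regular operators … Thus we can
investigate the operator G₂ perturbatively in the same way as the operator G₁ in (3.138)»: for `G₂⁻¹ = K₂ := K₃₁₈₃(R̃D*, 𝒥, P, W₀, T̃ + DΛ̃) + aQ̃ᵀQ̃`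
(`B9Eq3185.eq_3185_via_G2`'s `K + aQ̃ᵀQ̃`; `𝒥`, `W₀` symmetric) and the (3.128)-type `G₁♮⁻¹ = K₁ := (R̃D*)ᵀ(R̃D*) + T̃ᵀW₀T̃ + aQ̃ᵀQ̃`:
(i) `K₂ = K₁ + W_new` (§1); and GIVEN Theorem 3.12 for `G₁♮` — `K₁ > 0` (`hK₁`) and the sup block majorant `B_Ge^{−δ₁d}` of `G₁♮` (`hG₁`) —, the letters
on the sharp blocks of three carriers (fine bonds `b`, fine sites `n`, observed-field bonds `b₁`): `𝒥` (`c_J·m`, the `J`-form: (3.36)/(3.133)), `P`, `Pᵀ`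
(the observation `(I + D̄μ)Q`), `W₀D`, `DᵀW₀` (`c_E·m`, `c_E′·m`: (3.117)/(3.137)), `T̃`, `T̃ᵀ` ((3.49)/Thm 3.1), `Λ̃`, `Λ̃ᵀ` ((3.184)), `D`, all at the rate `δ₁`,
`3σ ≦ δ₁`, and «Mα₀ sufficiently small»: `B_G·c_W·m·c² < 1` with `c_W = 2C_P′c_JC_Pc² + C_T′c_EC_Λc² + C_Λ′c_E′C_Tc² + C_Λ′c_E′C_DC_Λc³`:
(ii) `K₂ > 0` — the Gaussian integral «(3.183) … with the δ-function δ(Q̃A) replaced by exp[−½⟨Q̃A, aQ̃A⟩]» defining `G₂` has a positive form;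
(iii) `G₂ = K₂⁻¹ > 0`; (iv) `G₂ = G₁♮(I + W_newG₁♮)⁻¹` and (v) `G₂ = Σₙ G₁♮(−W_newG₁♮)ⁿ` (sup operator norm) — the two members of (3.138) for `G₂`;
(vi) `G₂` has the block majorant `B_G(1 − B_Gc_Wmc²)⁻¹e^{−(δ₁−3σ)d}` — «the same properties» as `G₁♮`, constant and rate adjusted.
[cite: Balaban1985BackgroundPropagators, p.432 (after (3.186)), Thm 3.15 p.432, (3.183)–(3.184) p.432, (3.138) p.423, Thm 3.12 p.423, (3.128) p.421, (3.117) p.419]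
[cite: Balaban1984PropagatorsII, (2.52)–(2.55) p.232, (2.61) p.234] -/
theorem g2_of_letters (blkb : b → g.Site) (blkn : n → g.Site) (blkB : b₁ → g.Site)
    (RDt : Matrix r b ℝ) (𝒥 : Matrix b₁ b₁ ℝ) (h𝒥 : 𝒥ᵀ = 𝒥) (P : Matrix b₁ b ℝ) (W₀ Tw : Matrix b b ℝ)
    (hW₀ : W₀ᵀ = W₀) (D : Matrix b n ℝ) (Lam : Matrix n b ℝ) (Qt : Matrix τ b ℝ) (a : ℝ)
    (hK₁ : (RDtᵀ * RDt + Twᵀ * W₀ * Tw + a • (Qtᵀ * Qt)).PosDef)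
    {BG cJ cE cE' m CP CP' CT CT' CL CL' CD δ₁ σ c : ℝ}
    (htri : Triangle254 g) (hd : ∀ a b : g.Site, 0 ≤ g.dist a b) (hrow : RowSum g σ c) (hc0 : 0 ≤ c)
    (hBG : 0 ≤ BG) (hcJ : 0 ≤ cJ) (hcE : 0 ≤ cE) (hcE' : 0 ≤ cE') (hm : 0 ≤ m) (hCP : 0 ≤ CP) (hCP' : 0 ≤ CP')
    (hCT : 0 ≤ CT) (hCT' : 0 ≤ CT') (hCL : 0 ≤ CL) (hCL' : 0 ≤ CL') (hCD : 0 ≤ CD) (hσ : 0 ≤ σ)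
    (hσδ : σ + σ + σ ≤ δ₁)
    (hG₁ : HasMaj (BlockNorm.ofBlocks g blkb) (BlockNorm.ofBlocks g blkb)
      (Matrix.mulVecLin (RDtᵀ * RDt + Twᵀ * W₀ * Tw + a • (Qtᵀ * Qt))⁻¹)
      (fun a b => BG * Real.exp (-(δ₁ * g.dist a b))))
    (hJ : HasMaj (BlockNorm.ofBlocks g blkB) (BlockNorm.ofBlocks g blkB) (Matrix.mulVecLin 𝒥)
      (fun a b => cJ * m * Real.exp (-(δ₁ * g.dist a b))))
    (hP : HasMaj (BlockNorm.ofBlocks g blkb) (BlockNorm.ofBlocks g blkB) (Matrix.mulVecLin P)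
      (fun a b => CP * Real.exp (-(δ₁ * g.dist a b))))
    (hPt : HasMaj (BlockNorm.ofBlocks g blkB) (BlockNorm.ofBlocks g blkb) (Matrix.mulVecLin Pᵀ)
      (fun a b => CP' * Real.exp (-(δ₁ * g.dist a b))))
    (hE : HasMaj (BlockNorm.ofBlocks g blkn) (BlockNorm.ofBlocks g blkb) (Matrix.mulVecLin (W₀ * D))
      (fun a b => cE * m * Real.exp (-(δ₁ * g.dist a b))))
    (hEt : HasMaj (BlockNorm.ofBlocks g blkb) (BlockNorm.ofBlocks g blkn) (Matrix.mulVecLin (Dᵀ * W₀))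
      (fun a b => cE' * m * Real.exp (-(δ₁ * g.dist a b))))
    (hTw : HasMaj (BlockNorm.ofBlocks g blkb) (BlockNorm.ofBlocks g blkb) (Matrix.mulVecLin Tw)
      (fun a b => CT * Real.exp (-(δ₁ * g.dist a b))))
    (hTwt : HasMaj (BlockNorm.ofBlocks g blkb) (BlockNorm.ofBlocks g blkb) (Matrix.mulVecLin Twᵀ)
      (fun a b => CT' * Real.exp (-(δ₁ * g.dist a b))))
    (hL : HasMaj (BlockNorm.ofBlocks g blkb) (BlockNorm.ofBlocks g blkn) (Matrix.mulVecLin Lam)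
      (fun a b => CL * Real.exp (-(δ₁ * g.dist a b))))
    (hLt : HasMaj (BlockNorm.ofBlocks g blkn) (BlockNorm.ofBlocks g blkb) (Matrix.mulVecLin Lamᵀ)
      (fun a b => CL' * Real.exp (-(δ₁ * g.dist a b))))
    (hD : HasMaj (BlockNorm.ofBlocks g blkn) (BlockNorm.ofBlocks g blkb) (Matrix.mulVecLin D)
      (fun a b => CD * Real.exp (-(δ₁ * g.dist a b))))
    (hsmall : BG * ((2 * (CP' * cJ * CP * c * c) + CT' * cE * CL * c * c + CL' * cE' * CT * c * c +
      CL' * cE' * CD * CL * c * c * c) * m) * c * c < 1) :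
    -- (i) the perturbation identity `G₂⁻¹ = G₁♮⁻¹ + W_new`
    B9Eq3185.K3183 RDt 𝒥 P W₀ (Tw + D * Lam) + a • (Qtᵀ * Qt) =
      (RDtᵀ * RDt + Twᵀ * W₀ * Tw + a • (Qtᵀ * Qt)) +
        (-((2 : ℝ) • (Pᵀ * 𝒥 * P)) +
          (Twᵀ * (W₀ * D) * Lam + Lamᵀ * (Dᵀ * W₀) * Tw + Lamᵀ * (Dᵀ * W₀) * (D * Lam))) ∧
    -- (ii) `G₂⁻¹ > 0`: the Gaussian integral defining `G₂` (p. 432) makes sense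
    (B9Eq3185.K3183 RDt 𝒥 P W₀ (Tw + D * Lam) + a • (Qtᵀ * Qt)).PosDef ∧
    -- (iii) `G₂ > 0`, symmetric
    (B9Eq3185.K3183 RDt 𝒥 P W₀ (Tw + D * Lam) + a • (Qtᵀ * Qt))⁻¹.PosDef ∧
    -- (iv) the first equality of (3.138) for `G₂`: `G₂ = G₁♮(I + W_newG₁♮)⁻¹`
    (B9Eq3185.K3183 RDt 𝒥 P W₀ (Tw + D * Lam) + a • (Qtᵀ * Qt))⁻¹ =
      (RDtᵀ * RDt + Twᵀ * W₀ * Tw + a • (Qtᵀ * Qt))⁻¹ *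
        (1 + (-((2 : ℝ) • (Pᵀ * 𝒥 * P)) +
          (Twᵀ * (W₀ * D) * Lam + Lamᵀ * (Dᵀ * W₀) * Tw + Lamᵀ * (Dᵀ * W₀) * (D * Lam))) *
          (RDtᵀ * RDt + Twᵀ * W₀ * Tw + a • (Qtᵀ * Qt))⁻¹)⁻¹ ∧
    -- (v) the second equality of (3.138) for `G₂`: the convergent series `Σₙ G₁♮(−W_newG₁♮)ⁿ`
    HasSum (fun k : ℕ => (RDtᵀ * RDt + Twᵀ * W₀ * Tw + a • (Qtᵀ * Qt))⁻¹ *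
        (-(-((2 : ℝ) • (Pᵀ * 𝒥 * P)) +
          (Twᵀ * (W₀ * D) * Lam + Lamᵀ * (Dᵀ * W₀) * Tw + Lamᵀ * (Dᵀ * W₀) * (D * Lam))) *
          (RDtᵀ * RDt + Twᵀ * W₀ * Tw + a • (Qtᵀ * Qt))⁻¹) ^ k)
      (B9Eq3185.K3183 RDt 𝒥 P W₀ (Tw + D * Lam) + a • (Qtᵀ * Qt))⁻¹ ∧
    -- (vi) «the same properties»: the block majorant of `G₂`, exponential shape of `G₁♮`'s, constants changed
    HasMaj (BlockNorm.ofBlocks g blkb) (BlockNorm.ofBlocks g blkb)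
      (Matrix.mulVecLin (B9Eq3185.K3183 RDt 𝒥 P W₀ (Tw + D * Lam) + a • (Qtᵀ * Qt))⁻¹)
      (fun a b => BG * (1 - BG * ((2 * (CP' * cJ * CP * c * c) + CT' * cE * CL * c * c + CL' * cE' * CT * c * c +
        CL' * cE' * CD * CL * c * c * c) * m) * c * c)⁻¹ * Real.exp (-((δ₁ - σ - σ - σ) * g.dist a b))) := by
  -- names
  set K₁ : Matrix b b ℝ := RDtᵀ * RDt + Twᵀ * W₀ * Tw + a • (Qtᵀ * Qt) with hK₁def
  set Wn : Matrix b b ℝ := -((2 : ℝ) • (Pᵀ * 𝒥 * P)) +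
    (Twᵀ * (W₀ * D) * Lam + Lamᵀ * (Dᵀ * W₀) * Tw + Lamᵀ * (Dᵀ * W₀) * (D * Lam)) with hWndef
  set cW : ℝ := 2 * (CP' * cJ * CP * c * c) + CT' * cE * CL * c * c + CL' * cE' * CT * c * c +
    CL' * cE' * CD * CL * c * c * c with hcWdef
  -- §1: the algebra
  have hK₂ : B9Eq3185.K3183 RDt 𝒥 P W₀ (Tw + D * Lam) + a • (Qtᵀ * Qt) = K₁ + Wn :=
    (sub_eq_iff_eq_add'.mp (K2_sub_K1 RDt 𝒥 P W₀ Tw D Lam Qt a))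
  have hWt : Wnᵀ = Wn := Wnew_transpose 𝒥 h𝒥 P W₀ Tw hW₀ D Lam
  -- §2: the block majorant of the new terms at the rate `δ₁ − σ`
  have hcW0 : 0 ≤ cW := by positivity
  have hWmaj : HasMaj (BlockNorm.ofBlocks g blkb) (BlockNorm.ofBlocks g blkb) (Matrix.mulVecLin Wn)
      (fun a b => cW * m * Real.exp (-((δ₁ - σ) * g.dist a b))) := by
    have h := hasMaj_newTerms (ρ := δ₁ - σ) htri hd hrow hc0 hcJ hcE hcE' hm hCP hCP' hCT hCT' hCL hCL' hCD
      (by linarith) hσ (by linarith) hJ hP hPt hE hEt hTw hTwt hL hLt hD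
    rw [← mulVecLin_newTerms] at h
    have hκb : (BlockNorm.ofBlocks g blkb).κ = 1 := rfl
    have hκn : (BlockNorm.ofBlocks g blkn).κ = 1 := rfl
    have hκB : (BlockNorm.ofBlocks g blkB).κ = 1 := rfl
    refine h.mono fun a b => le_of_eq ?_
    rw [hκb, hκn, hκB, hcWdef]
    ring
  -- §3: the resolvent step at `δ₁ − σ`
  have hG₁' := hG₁.of_rate_le hd hBG (show δ₁ - σ ≤ δ₁ by linarith)
  obtain ⟨-, hleft, -, -, hpos, hK₂pos, hinv, hsum⟩ :=
    g2_expansion blkb K₁ Wn hK₁ hWt htri hd hrow hc0 hBG hcW0 hm hσ (by linarith) hG₁' hWmaj hsmall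
  have hK₁det : IsUnit K₁.det := (Matrix.isUnit_iff_isUnit_det _).mp hK₁.isUnit
  have hG₂eq : (K₁ + Wn) * (K₁ + Wn)⁻¹ = 1 := by rw [hinv]; exact hleft
  have hmaj := g2_majorant blkb K₁ Wn (K₁ + Wn)⁻¹ hK₁det hG₂eq htri hd hrow hc0 hBG hcW0 hm hσ (by linarith)
    hG₁' hWmaj hsmall
  refine ⟨hK₂, ?_, ?_, ?_, ?_, ?_⟩
  · rw [hK₂]; exact hK₂pos
  · rw [hK₂, hinv]; exact hpos
  · rw [hK₂, hinv]
  · rw [hK₂, hinv]; exact hsum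
  · rw [hK₂]; exact hmaj

end EndToEnd

/-! ## §5 The letters of §4 from the printed objects: `λ̃` by (3.184), `(Δ + Δ⁽²⁾)D` by (3.117)/(3.137), `P = (I + D̄μ)Q` -/

section PrintedLetters

variable {g : B6.Geometry} {FX FN FB FM : Type} [AddCommGroup FX] [Module ℝ FX] [AddCommGroup FN] [Module ℝ FN]
  [AddCommGroup FB] [Module ℝ FB] [AddCommGroup FM] [Module ℝ FM]
variable {bX : BlockNorm g FX} {bN : BlockNorm g FN} {bB : BlockNorm g FB} {bM : BlockNorm g FM}

/-- **«The analysis is even simpler because the new terms are more regular, as it follows easily from (3.184)»**: `Λ̃ = H′∘C′⁽ᵏ⁾(Λ)∘(H′ᵀΔ)∘(P̃D*) +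
H′∘μ∘Q + H′∘Q′∘(G̃′R̃D*)` is a sum of words in REGULAR letters — `H′ : bM → bN` (`C_H`), `C′⁽ᵏ⁾(Λ) : bM → bM` (`C_C`; (3.174) «all properties of
C⁽ᵏ⁾(Λ)»), `H′ᵀΔ : bN → bM` (`C_H′`; (3.177) «ΔH′μ is a regular function»), `P̃D* : bX → bN` (`C_PD`; (3.49)), `μ : bB → bM` (`C_μ`; (3.169)), `Q : bX → bB`
(`C_Q`), `Q′ : bN → bM` (`C_Q′`), `G̃′R̃D* : bX → bN` (`C_W`; Theorem 3.1 ∘ (3.49)) — hence has the majorant `C_Λe^{−ρd}`,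
`C_Λ = κ_MC_H(κ_MC_C(κ_NC_H′C_PDc)c)c + κ_MC_H(κ_BC_μC_Qc)c + κ_MC_H(κ_NC_Q′C_Wc)c`, with NO small factor («regular»).
[cite: Balaban1985BackgroundPropagators, (3.184) p.432, (3.177) p.431, (3.174) p.431, (3.169) p.430, (3.49) p.399] [cite: Balaban1984PropagatorsII, (2.52)–(2.55) p.232, (2.61) p.234] -/
theorem hasMaj_lam_of_3184 {Hf : FM →ₗ[ℝ] FN} {Cf : FM →ₗ[ℝ] FM} {HtDf : FN →ₗ[ℝ] FM} {PDtf : FX →ₗ[ℝ] FN}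
    {Muf : FB →ₗ[ℝ] FM} {Qf : FX →ₗ[ℝ] FB} {Qpf : FN →ₗ[ℝ] FM} {GRDtf : FX →ₗ[ℝ] FN}
    {CH CC CH' CPD CMu CQ CQp CW δ₁ ρ σ c : ℝ}
    (htri : Triangle254 g) (hd : ∀ a b : g.Site, 0 ≤ g.dist a b) (hrow : RowSum g σ c) (hc0 : 0 ≤ c)
    (hCH : 0 ≤ CH) (hCC : 0 ≤ CC) (hCH' : 0 ≤ CH') (hCPD : 0 ≤ CPD) (hCMu : 0 ≤ CMu) (hCQ : 0 ≤ CQ)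
    (hCQp : 0 ≤ CQp) (hCW : 0 ≤ CW) (hρ : 0 ≤ ρ) (hσ : 0 ≤ σ) (hρδ : ρ + σ ≤ δ₁)
    (hH : HasMaj bM bN Hf (fun a b => CH * Real.exp (-(δ₁ * g.dist a b))))
    (hC : HasMaj bM bM Cf (fun a b => CC * Real.exp (-(δ₁ * g.dist a b))))
    (hHtD : HasMaj bN bM HtDf (fun a b => CH' * Real.exp (-(δ₁ * g.dist a b))))
    (hPDt : HasMaj bX bN PDtf (fun a b => CPD * Real.exp (-(δ₁ * g.dist a b))))
    (hMu : HasMaj bB bM Muf (fun a b => CMu * Real.exp (-(δ₁ * g.dist a b))))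
    (hQ : HasMaj bX bB Qf (fun a b => CQ * Real.exp (-(δ₁ * g.dist a b))))
    (hQp : HasMaj bN bM Qpf (fun a b => CQp * Real.exp (-(δ₁ * g.dist a b))))
    (hGRDt : HasMaj bX bN GRDtf (fun a b => CW * Real.exp (-(δ₁ * g.dist a b)))) :
    HasMaj bX bN (Hf ∘ₗ (Cf ∘ₗ (HtDf ∘ₗ PDtf)) + Hf ∘ₗ (Muf ∘ₗ Qf) + Hf ∘ₗ (Qpf ∘ₗ GRDtf))
      (fun a b => (bM.κ * CH * (bM.κ * CC * (bN.κ * CH' * CPD * c) * c) * c + bM.κ * CH * (bB.κ * CMu * CQ * c) * c +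
          bM.κ * CH * (bN.κ * CQp * CW * c) * c) * Real.exp (-(ρ * g.dist a b))) := by
  -- the first piece `H′C′H′*ΔP̃D*`
  have h11 : HasMaj bX bM (HtDf ∘ₗ PDtf) (fun a b => bN.κ * CH' * CPD * c * Real.exp (-(ρ * g.dist a b))) :=
    hasMaj_comp_exp htri hd hrow hCH' hCPD hρ (by linarith) hρδ hHtD hPDt
  have h11c : 0 ≤ bN.κ * CH' * CPD * c := mul_nonneg (mul_nonneg (mul_nonneg bN.κ_nonneg hCH') hCPD) hc0
  have h12 : HasMaj bX bM (Cf ∘ₗ (HtDf ∘ₗ PDtf))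
      (fun a b => bM.κ * CC * (bN.κ * CH' * CPD * c) * c * Real.exp (-(ρ * g.dist a b))) :=
    hasMaj_comp_exp htri hd hrow hCC h11c hρ le_rfl hρδ hC h11
  have h12c : 0 ≤ bM.κ * CC * (bN.κ * CH' * CPD * c) * c := mul_nonneg (mul_nonneg (mul_nonneg bM.κ_nonneg hCC) h11c) hc0
  have h1 : HasMaj bX bN (Hf ∘ₗ (Cf ∘ₗ (HtDf ∘ₗ PDtf)))
      (fun a b => bM.κ * CH * (bM.κ * CC * (bN.κ * CH' * CPD * c) * c) * c * Real.exp (-(ρ * g.dist a b))) :=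
    hasMaj_comp_exp htri hd hrow hCH h12c hρ le_rfl hρδ hH h12
  -- the second piece `H′μQ`
  have h21 : HasMaj bX bM (Muf ∘ₗ Qf) (fun a b => bB.κ * CMu * CQ * c * Real.exp (-(ρ * g.dist a b))) :=
    hasMaj_comp_exp htri hd hrow hCMu hCQ hρ (by linarith) hρδ hMu hQ
  have h21c : 0 ≤ bB.κ * CMu * CQ * c := mul_nonneg (mul_nonneg (mul_nonneg bB.κ_nonneg hCMu) hCQ) hc0
  have h2 : HasMaj bX bN (Hf ∘ₗ (Muf ∘ₗ Qf))
      (fun a b => bM.κ * CH * (bB.κ * CMu * CQ * c) * c * Real.exp (-(ρ * g.dist a b))) :=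
    hasMaj_comp_exp htri hd hrow hCH h21c hρ le_rfl hρδ hH h21
  -- the third piece `H′Q′G̃′R̃D*`
  have h31 : HasMaj bX bM (Qpf ∘ₗ GRDtf) (fun a b => bN.κ * CQp * CW * c * Real.exp (-(ρ * g.dist a b))) :=
    hasMaj_comp_exp htri hd hrow hCQp hCW hρ (by linarith) hρδ hQp hGRDt
  have h31c : 0 ≤ bN.κ * CQp * CW * c := mul_nonneg (mul_nonneg (mul_nonneg bN.κ_nonneg hCQp) hCW) hc0
  have h3 : HasMaj bX bN (Hf ∘ₗ (Qpf ∘ₗ GRDtf))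
      (fun a b => bM.κ * CH * (bN.κ * CQp * CW * c) * c * Real.exp (-(ρ * g.dist a b))) :=
    hasMaj_comp_exp htri hd hrow hCH h31c hρ le_rfl hρδ hH h31
  exact ((h1.add h2).add h3).mono fun a b => le_of_eq (by ring)

/-- **the small letter `(Δ + Δ⁽²⁾)D = ΔD + Δ⁽²⁾∘D`** from the (3.117) letter `ΔD : bN → bX` (`c_J·m·e^{−δ₁d}` — «the error terms are small because the
function J … is small», r06 FILE 82's `hJ1`), the (3.137) letter `Δ⁽²⁾ : bX → bX` (`c₂·m·e^{−δ₁d}` — «|(Δ⁽²⁾A)(b)| ≦ O(1)Mα₀(Lʲη)⁻²|A|») and `D : bN → bX`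
(`C_D`): majorant `(c_J + κ_Xc₂C_Dc)·m·e^{−ρd}`. [cite: Balaban1985BackgroundPropagators, (3.117) p.419, (3.137) p.423, p.432 (after (3.186))] [cite: Balaban1984PropagatorsII, (2.52)–(2.55) p.232, (2.61) p.234] -/
theorem hasMaj_E_of_3117_3137 {KDf : FN →ₗ[ℝ] FX} {D2f : FX →ₗ[ℝ] FX} {Df : FN →ₗ[ℝ] FX}
    {cJ c₂ m CD δ₁ ρ σ c : ℝ}
    (htri : Triangle254 g) (hd : ∀ a b : g.Site, 0 ≤ g.dist a b) (hrow : RowSum g σ c)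
    (hcJ : 0 ≤ cJ) (hc₂ : 0 ≤ c₂) (hm : 0 ≤ m) (hCD : 0 ≤ CD) (hρ : 0 ≤ ρ) (hσ : 0 ≤ σ) (hρδ : ρ + σ ≤ δ₁)
    (hKD : HasMaj bN bX KDf (fun a b => cJ * m * Real.exp (-(δ₁ * g.dist a b))))
    (hD2 : HasMaj bX bX D2f (fun a b => c₂ * m * Real.exp (-(δ₁ * g.dist a b))))
    (hD : HasMaj bN bX Df (fun a b => CD * Real.exp (-(δ₁ * g.dist a b)))) :
    HasMaj bN bX (KDf + D2f ∘ₗ Df) (fun a b => (cJ + bX.κ * c₂ * CD * c) * m * Real.exp (-(ρ * g.dist a b))) := by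
  have h1 := hKD.of_rate_le hd (mul_nonneg hcJ hm) (show ρ ≤ δ₁ by linarith)
  have h2 : HasMaj bN bX (D2f ∘ₗ Df) (fun a b => bX.κ * (c₂ * m) * CD * c * Real.exp (-(ρ * g.dist a b))) :=
    hasMaj_comp_exp htri hd hrow (mul_nonneg hc₂ hm) hCD hρ (by linarith) hρδ hD2 hD
  exact (h1.add h2).mono fun a b => le_of_eq (by ring)

/-- **the small letter `Dᵀ(Δ + Δ⁽²⁾) = DᵀΔ + Dᵀ∘Δ⁽²⁾`** from the (3.117) letter `DᵀΔ : bX → bN` (`c_J′·m`, FILE 82's `hJt`), the (3.137) letter `Δ⁽²⁾`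
(`c₂·m`) and `Dᵀ : bX → bN` (`C_D′`): majorant `(c_J′ + κ_XC_D′c₂c)·m·e^{−ρd}`.
[cite: Balaban1985BackgroundPropagators, (3.117) p.419, (3.137) p.423, p.432 (after (3.186))] [cite: Balaban1984PropagatorsII, (2.52)–(2.55) p.232, (2.61) p.234] -/
theorem hasMaj_Et_of_3117_3137 {DtKf : FX →ₗ[ℝ] FN} {D2f : FX →ₗ[ℝ] FX} {Dtf : FX →ₗ[ℝ] FN}
    {cJ' c₂ m CD' δ₁ ρ σ c : ℝ}
    (htri : Triangle254 g) (hd : ∀ a b : g.Site, 0 ≤ g.dist a b) (hrow : RowSum g σ c)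
    (hcJ' : 0 ≤ cJ') (hc₂ : 0 ≤ c₂) (hm : 0 ≤ m) (hCD' : 0 ≤ CD') (hρ : 0 ≤ ρ) (hσ : 0 ≤ σ) (hρδ : ρ + σ ≤ δ₁)
    (hDtK : HasMaj bX bN DtKf (fun a b => cJ' * m * Real.exp (-(δ₁ * g.dist a b))))
    (hD2 : HasMaj bX bX D2f (fun a b => c₂ * m * Real.exp (-(δ₁ * g.dist a b))))
    (hDt : HasMaj bX bN Dtf (fun a b => CD' * Real.exp (-(δ₁ * g.dist a b)))) :
    HasMaj bX bN (DtKf + Dtf ∘ₗ D2f) (fun a b => (cJ' + bX.κ * CD' * c₂ * c) * m * Real.exp (-(ρ * g.dist a b))) := by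
  have h1 := hDtK.of_rate_le hd (mul_nonneg hcJ' hm) (show ρ ≤ δ₁ by linarith)
  have h2 : HasMaj bX bN (Dtf ∘ₗ D2f) (fun a b => bX.κ * CD' * (c₂ * m) * c * Real.exp (-(ρ * g.dist a b))) :=
    hasMaj_comp_exp htri hd hrow hCD' (mul_nonneg hc₂ hm) hρ (by linarith) hρδ hDt hD2
  exact (h1.add h2).mono fun a b => le_of_eq (by ring)

/-- **the observation `P = (I + D̄μ)Q = Q + D̄μQ`** of (3.183)/(3.185) from the letters `Q : bX → bB` (`C_Q`; (3.13)–(3.15), |Q| ≦ 1, block-local),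
`μ : bB → bM` (`C_μ`; (3.169), local with range `L` and row mass `1 + 4d(L − 1)` — `B9Eq3169Comb`/`B9Eq3187Op`), `D̄ : bM → bB` (`C_D̄`): majorant
`(C_Q + κ_MC_D̄(κ_BC_μC_Qc)c)·e^{−ρd}`. [cite: Balaban1985BackgroundPropagators, (3.185) p.432, (3.169) p.430, (3.183) p.432] [cite: Balaban1984PropagatorsII, (2.52)–(2.55) p.232, (2.61) p.234] -/
theorem hasMaj_P_of_letters {Qf : FX →ₗ[ℝ] FB} {Muf : FB →ₗ[ℝ] FM} {Dbf : FM →ₗ[ℝ] FB}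
    {CQ CMu CDb δ₁ ρ σ c : ℝ}
    (htri : Triangle254 g) (hd : ∀ a b : g.Site, 0 ≤ g.dist a b) (hrow : RowSum g σ c) (hc0 : 0 ≤ c)
    (hCQ : 0 ≤ CQ) (hCMu : 0 ≤ CMu) (hCDb : 0 ≤ CDb) (hρ : 0 ≤ ρ) (hσ : 0 ≤ σ) (hρδ : ρ + σ ≤ δ₁)
    (hQ : HasMaj bX bB Qf (fun a b => CQ * Real.exp (-(δ₁ * g.dist a b))))
    (hMu : HasMaj bB bM Muf (fun a b => CMu * Real.exp (-(δ₁ * g.dist a b))))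
    (hDb : HasMaj bM bB Dbf (fun a b => CDb * Real.exp (-(δ₁ * g.dist a b)))) :
    HasMaj bX bB (Qf + Dbf ∘ₗ (Muf ∘ₗ Qf))
      (fun a b => (CQ + bM.κ * CDb * (bB.κ * CMu * CQ * c) * c) * Real.exp (-(ρ * g.dist a b))) := by
  have h0 := hQ.of_rate_le hd hCQ (show ρ ≤ δ₁ by linarith)
  have h1 : HasMaj bX bM (Muf ∘ₗ Qf) (fun a b => bB.κ * CMu * CQ * c * Real.exp (-(ρ * g.dist a b))) :=
    hasMaj_comp_exp htri hd hrow hCMu hCQ hρ (by linarith) hρδ hMu hQ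
  have h1c : 0 ≤ bB.κ * CMu * CQ * c := mul_nonneg (mul_nonneg (mul_nonneg bB.κ_nonneg hCMu) hCQ) hc0
  have h2 : HasMaj bX bB (Dbf ∘ₗ (Muf ∘ₗ Qf))
      (fun a b => bM.κ * CDb * (bB.κ * CMu * CQ * c) * c * Real.exp (-(ρ * g.dist a b))) :=
    hasMaj_comp_exp htri hd hrow hCDb h1c hρ le_rfl hρδ hDb h1
  exact (h0.add h2).mono fun a b => le_of_eq (by ring)

end PrintedLetters

section PrintedLettersMatrix

variable {b n b₁ m : Type*} [Fintype b] [Fintype n] [Fintype b₁] [Fintype m] [DecidableEq n] [DecidableEq b₁]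

omit [DecidableEq b₁] in
/-- the matrix `Λ̃` of §1 (`lamT_eq_mulVec`) IS §5's word in the matrix letters `mulVecLin H′`, `mulVecLin C′`, `mulVecLin (H′ᵀΔ)`,
`mulVecLin ((1 − R̃)Dᵀ)`, `mulVecLin Mu`, `mulVecLin Q`, `mulVecLin Q′`, `mulVecLin (G̃′R̃Dᵀ)`. [cite: Balaban1985BackgroundPropagators, (3.184) p.432] -/
theorem mulVecLin_lamMatrix (D : Matrix b n ℝ) (Δs Gw Rw : Matrix n n ℝ) (Q : Matrix b₁ b ℝ) (Qp : Matrix m n ℝ)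
    (Hp : Matrix n m ℝ) (Cp : Matrix m m ℝ) (Mu : Matrix m b₁ ℝ) :
    Matrix.mulVecLin (Hp * Cp * Hpᵀ * Δs * (1 - Rw) * Dᵀ + Hp * Mu * Q + Hp * Qp * Gw * Rw * Dᵀ) =
      Matrix.mulVecLin Hp ∘ₗ (Matrix.mulVecLin Cp ∘ₗ (Matrix.mulVecLin (Hpᵀ * Δs) ∘ₗ Matrix.mulVecLin ((1 - Rw) * Dᵀ))) +
        Matrix.mulVecLin Hp ∘ₗ (Matrix.mulVecLin Mu ∘ₗ Matrix.mulVecLin Q) +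
        Matrix.mulVecLin Hp ∘ₗ (Matrix.mulVecLin Qp ∘ₗ Matrix.mulVecLin (Gw * Rw * Dᵀ)) := by
  apply LinearMap.ext
  intro v
  simp only [Matrix.mulVecLin_apply, LinearMap.add_apply, LinearMap.comp_apply, Matrix.add_mulVec,
    Matrix.mulVec_mulVec, Matrix.mul_assoc]

omit [DecidableEq n] in
/-- `(K + Δ₂)D = KD + Δ₂∘D` as linear maps (`K` the Hessian `Δ`, `Δ₂` the matrix of `Δ⁽²⁾`): the shape consumed by `hasMaj_E_of_3117_3137`.
[cite: Balaban1985BackgroundPropagators, (3.117) p.419, (3.137) p.423] -/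
theorem mulVecLin_E (K D2 : Matrix b b ℝ) (D : Matrix b n ℝ) :
    Matrix.mulVecLin ((K + D2) * D) = Matrix.mulVecLin (K * D) + Matrix.mulVecLin D2 ∘ₗ Matrix.mulVecLin D := by
  rw [Matrix.add_mul, Matrix.mulVecLin_add, Matrix.mulVecLin_mul D2 D]

omit [DecidableEq n] [Fintype n] in
/-- `Dᵀ(K + Δ₂) = DᵀK + Dᵀ∘Δ₂` as linear maps: the shape consumed by `hasMaj_Et_of_3117_3137`.
[cite: Balaban1985BackgroundPropagators, (3.117) p.419, (3.137) p.423] -/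
theorem mulVecLin_Et (K D2 : Matrix b b ℝ) (D : Matrix b n ℝ) :
    Matrix.mulVecLin (Dᵀ * (K + D2)) = Matrix.mulVecLin (Dᵀ * K) + Matrix.mulVecLin Dᵀ ∘ₗ Matrix.mulVecLin D2 := by
  rw [Matrix.mul_add, Matrix.mulVecLin_add, Matrix.mulVecLin_mul Dᵀ D2]

omit [DecidableEq n] in
/-- `(1 + D̄·Mu)Q = Q + D̄∘Mu∘Q` as linear maps (`B9Eq3185.obs_3183`'s observation): the shape consumed by `hasMaj_P_of_letters`.
[cite: Balaban1985BackgroundPropagators, (3.183) p.432, (3.185) p.432] -/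
theorem mulVecLin_P (Q : Matrix b₁ b ℝ) (Db : Matrix b₁ m ℝ) (Mu : Matrix m b₁ ℝ) :
    Matrix.mulVecLin ((1 + Db * Mu) * Q) =
      Matrix.mulVecLin Q + Matrix.mulVecLin Db ∘ₗ (Matrix.mulVecLin Mu ∘ₗ Matrix.mulVecLin Q) := by
  rw [Matrix.add_mul, Matrix.one_mul, Matrix.mulVecLin_add, Matrix.mul_assoc, Matrix.mulVecLin_mul,
    Matrix.mulVecLin_mul]

end PrintedLettersMatrix

/-! ## §6 (v1.1) THE (3.128)-TYPE OPERATOR `G₁♮⁻¹` IS p10's ∕ r06's `Ginv`∕`G1inv`: Theorem 3.12's inputs for `G₁♮` BY NAME -/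

section Bridge

variable {b n m q : Type*} [Fintype b] [Fintype n] [Fintype m] [Fintype q] [DecidableEq b] [DecidableEq n] [DecidableEq m]

omit [Fintype b] [DecidableEq b] in
/-- `(RDᵀ)ᵀ(RDᵀ) = DRDᵀ` for the orthogonal projection `R` of (3.25) («R = R(U) is an orthogonal projection», p. 394; `B9SectECov.R_transpose`,
`B9SectECov.R_mul_R`): the gauge-fixing term `‖R̃D*A‖²` of (3.183)/(3.128) as the matrix `DR̃Dᵀ` of p10's `B9SectDFP.Ginv`.
[cite: Balaban1985BackgroundPropagators, (3.25) p.394, (3.128) p.421, (3.183) p.432] -/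
theorem RDt_transpose_mul_RDt (Δ : Matrix n n ℝ) (hΔ : Δ.IsSymm) (Q : Matrix m n ℝ) (a : ℝ) (hM' : IsUnit (B9H163.M' Δ Q a))
    (D : Matrix b n ℝ) :
    (B9H163.R Δ Q a * Dᵀ)ᵀ * (B9H163.R Δ Q a * Dᵀ) = D * B9H163.R Δ Q a * Dᵀ := by
  rw [Matrix.transpose_mul, Matrix.transpose_transpose, B9SectECov.R_transpose Δ Q a hΔ, Matrix.mul_assoc,
    ← Matrix.mul_assoc (B9H163.R Δ Q a) (B9H163.R Δ Q a), B9SectECov.R_mul_R Δ Q a hM', ← Matrix.mul_assoc]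

/-- **`G₁♮⁻¹` IS `B9SectDFP.Ginv`** at the letters `R̃D* := R(Δ,Q̃′,a)·Dᵀ`, `T̃ := tOp Δ Q̃′ a D = 1 − DG̃′R̃Dᵀ`, the form `W₀` in the slot `K`:
`(R̃D*)ᵀ(R̃D*) + T̃ᵀW₀T̃ + a′Q̃ᵀQ̃ = Ginv W₀ Δ Q̃′ a D Q̃ a′ = T̃ᵀW₀T̃ + DR̃Dᵀ + a′Q̃ᵀQ̃` ((3.122)/(3.128) at p10's matrix level) — so the
Theorem 3.12-type inputs `hK₁`, `hG₁` of §3/§4 for `G₁♮` are, at these letters, r06's `B9Thm312Positivity.thm312_posDef_G`∕`eq3130_hasSum_posDef`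
(positivity, series) and `B9Eq3130MatrixLetters.thm312_posDef_G_letters` (from letters) BY NAME; with `W₀ := K − 2𝒞` it is `B9Eq3152.G1inv K 𝒞 …`
(`K1_eq_G1inv`). [cite: Balaban1985BackgroundPropagators, (3.128) p.421, (3.122) p.420, (3.138) p.423, Thm 3.12 p.423] -/
theorem K1_eq_Ginv (W₀ : Matrix b b ℝ) (Δ : Matrix n n ℝ) (hΔ : Δ.IsSymm) (Q : Matrix m n ℝ) (a : ℝ)
    (hM' : IsUnit (B9H163.M' Δ Q a)) (D : Matrix b n ℝ) (Qb : Matrix q b ℝ) (ab : ℝ) :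
    (B9H163.R Δ Q a * Dᵀ)ᵀ * (B9H163.R Δ Q a * Dᵀ) + (B9SectDFP.tOp Δ Q a D)ᵀ * W₀ * B9SectDFP.tOp Δ Q a D +
        ab • (Qbᵀ * Qb) =
      B9SectDFP.Ginv W₀ Δ Q a D Qb ab := by
  rw [RDt_transpose_mul_RDt Δ hΔ Q a hM' D, B9SectDFP.Ginv, B9SectDFP.piOp]
  abel

/-- the same with `W₀ := K − 2𝒞` (`𝒞 = ½Δ⁽²⁾`): `G₁♮⁻¹ = B9Eq3152.G1inv K 𝒞 Δ Q̃′ a D Q̃ a′` — r06 FILES 81–83's `G₁`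
(`thm312_posDef_G1_letters`, `thm312_posDef_G1_assembled`, `B9Eq3120StepDelta1Pi.thm312_G1_rightEntry_step1`).
[cite: Balaban1985BackgroundPropagators, (3.128) p.421, (3.138) p.423, Thm 3.12 p.423] -/
theorem K1_eq_G1inv (K C : Matrix b b ℝ) (Δ : Matrix n n ℝ) (hΔ : Δ.IsSymm) (Q : Matrix m n ℝ) (a : ℝ)
    (hM' : IsUnit (B9H163.M' Δ Q a)) (D : Matrix b n ℝ) (Qb : Matrix q b ℝ) (ab : ℝ) :
    (B9H163.R Δ Q a * Dᵀ)ᵀ * (B9H163.R Δ Q a * Dᵀ) +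
        (B9SectDFP.tOp Δ Q a D)ᵀ * (K - (2 : ℝ) • C) * B9SectDFP.tOp Δ Q a D + ab • (Qbᵀ * Qb) =
      B9Eq3152.G1inv K C Δ Q a D Qb ab := by
  rw [K1_eq_Ginv (K - (2 : ℝ) • C) Δ hΔ Q a hM' D Qb ab, B9Eq3152.G1inv]

variable {b₁ : Type*} [Fintype b₁]

/-- **`G₂⁻¹ = Ginv W₀ … + W_new`** at p10's letters: `K₃₁₈₃(R̃Dᵀ, 𝒥, P, W₀, tOp + DΛ̃) + a′Q̃ᵀQ̃ = B9SectDFP.Ginv W₀ Δ Q̃′ a D Q̃ a′ + W_new` — §1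
`K2_sub_K1` + `K1_eq_Ginv`; the (3.138) step of §3 is then LITERALLY r06's step for `Ginv`/`G1inv` with one more perturbation.
[cite: Balaban1985BackgroundPropagators, p.432 (after (3.186)), (3.138) p.423, (3.128) p.421] -/
theorem K2_eq_Ginv_add_newTerms (𝒥 : Matrix b₁ b₁ ℝ) (P : Matrix b₁ b ℝ) (W₀ : Matrix b b ℝ) (Δ : Matrix n n ℝ) (hΔ : Δ.IsSymm)
    (Q : Matrix m n ℝ) (a : ℝ) (hM' : IsUnit (B9H163.M' Δ Q a)) (D : Matrix b n ℝ) (Lam : Matrix n b ℝ) (Qb : Matrix q b ℝ)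
    (ab : ℝ) :
    B9Eq3185.K3183 (B9H163.R Δ Q a * Dᵀ) 𝒥 P W₀ (B9SectDFP.tOp Δ Q a D + D * Lam) + ab • (Qbᵀ * Qb) =
      B9SectDFP.Ginv W₀ Δ Q a D Qb ab +
        (-((2 : ℝ) • (Pᵀ * 𝒥 * P)) +
          ((B9SectDFP.tOp Δ Q a D)ᵀ * (W₀ * D) * Lam + Lamᵀ * (Dᵀ * W₀) * B9SectDFP.tOp Δ Q a D +
            Lamᵀ * (Dᵀ * W₀) * (D * Lam))) := by
  rw [← K1_eq_Ginv W₀ Δ hΔ Q a hM' D Qb ab]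
  exact sub_eq_iff_eq_add'.mp (K2_sub_K1 (B9H163.R Δ Q a * Dᵀ) 𝒥 P W₀ (B9SectDFP.tOp Δ Q a D) D Lam Qb ab)

end Bridge

end Literature.MathematicalPhysics.QuantumFieldTheory.Balaban1983to89.B9Eq3186G2Perturbation

end
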